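import Literature.Computability.Cryptography.IndistinguishableFarEnsembles
import Literature.Computability.Cryptography.IndistinguishableFarEnsemblesAttempt
import Literature.Computability.Cryptography.IndistinguishableFarEnsemblesMath
import Literature.Computability.Cryptography.YaoInvProgram
import HarnessLib

/-!
# Constructible, indistinguishable, far-apart ensembles give one-way functions: the distinguisher, the reduction, the machine, and the discharge

This file completes the discharge of the named fact `Goldreich2001_owfExist_of_indistinguishable_farApart`
(`IndistinguishableFarEnsembles.lean`; Goldreich 2001, §3.8 Exercise 11 with Ch. 2 Exercise 17, and Goldreich 2010,
Exercise 2.8), building on the sibling files `IndistinguishableFarEnsembles{Math,Sampler,Function,Attempt}.lean`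
(parts I–IV: the Cauchy–Schwarz / first-success estimates, the length-preserving `f̃ : (σ, r) ↦ S_σ(r)` with
coin-count guesses, Impagliazzo–Luby's hashed candidate `F = g f̃`, and one inversion attempt against `F`).
It has four parts, kept verbatim in the shape of the plan recorded in parts I–IV:

* **Part V — the distinguisher** (`FarApartOWF.Ctx.scan`, `FarApartOWF.Params.dist`): from an inverter `A` of `F`,
  scan the hash levels top-down, `T` attempts each, and answer with the selector bit of the first valid answer;
  its acceptance probability is a first-success value and satisfies the per-image bound and the
  `Δ(Xₙ, Yₙ)² − 2·err ≤ advantage` estimate (`FarApartOWF.Ctx.sq_tvDist_sub_le_distAdvantage`).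
* **Part VI — the asymptotic reduction** (`FarApartOWF.Params.isWeaklyOneWay_F`,
  `FarApartOWF.Params.weakOWFExist_of_samplers`): `F` is weakly one-way, the efficiency of the distinguisher being a
  hypothesis, exactly in the format of `CommitmentOneWay.Params.isWeaklyOneWay_F`.
* **Part VII — the distinguisher is PPT** (`FarApartOWF.DProg.dist_isPPT`), brick algebra as everywhere in the tree.
* **Part VIII — the discharge** `Goldreich2001_owfExist_of_indistinguishable_farApart_holds`: parts VI + VII give a
  weak one-way function, and Yao's amplification (`weakOWFExist_iff_OWFExist_holds`, Goldreich 2001, Thm. 2.3.2)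
  a one-way function.

Deviations from the printed guideline (documented at the relevant declarations): no preliminary amplification to
almost-disjoint supports (the posterior-bit distinguisher has advantage `≥ Δ²` by Cauchy–Schwarz, which suffices),
and the distributional-inversion step of Ch. 2 Exercise 17 is specialised to a top-down scan over the hash levels
instead of Impagliazzo–Luby's estimation of the preimage size.

## References

* O. Goldreich, *Foundations of Cryptography I: Basic Tools*, CUP 2001, §3.8 Exercise 11 and its guideline
  (PDF p. 212), Ch. 2 Exercise 17 and its guideline (PDF p. 126), Thm. 2.3.2, Def. 2.2.2, Def. 3.2.2.
* O. Goldreich, *A Primer on Pseudorandom Generators*, AMS 2010, Exercise 2.8 (PDF p. 46).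
* R. Impagliazzo, M. Luby, *One-way functions are essential for complexity based cryptography*, FOCS 1989, §4.
* S. Arora, B. Barak, *Computational Complexity: A Modern Approach*, CUP 2009, §1.3–1.4, §7.1.
-/

/-!
## Part V — the distinguisher and its acceptance probability

Part V of the discharge of `Goldreich2001_owfExist_of_indistinguishable_farApart` (Goldreich 2001, §3.8
Exercise 11 with Ch. 2 Exercise 17). From an inverter `A` of the hashed candidate `F` we build the
distinguisher `D` of the two ensembles: on `⟨1ⁿ, z⟩` it forms the slice image `y = bits ℓ₀ ‖ bits ℓ₁ ‖ enc z`
and **scans the hash levels `i = L, L−1, …, 0`, `T` attempts each** (attempts as in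
`IndistinguishableFarEnsemblesAttempt.lean`), answering with the selector bit of the first valid answer and with
a fresh coin if every attempt fails — the "output a uniformly chosen preimage and read off `σ`" step of the
guideline, made robust against inverters that answer only on crowded hash levels by taking the HIGHEST level that
answers (there the preimage with a given hash prefix is essentially unique, so the answer is essentially a uniform
element of the fibre). As in `CommitmentOneWay.lean`, the parameters `D` cannot compute — the attacked input length
`m` of `F`, the two coin counts `ℓ₀(n), ℓ₁(n)` of the samplers and `A`'s own coin count `κ` — travel in `D`'s coin
budget (`Params.code`, `Params.cl`, decoded in base `B(|input|)`), well defined along a sparse set of parameters.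

Contents:
* `Ctx.att`, `Ctx.scan`, `Ctx.levels`, `Params.dRun` / `Params.dist` (the distinguisher as a `RandAlg`),
  `Params.Bpoly`, `Params.code`, `Params.cl` (+ `cl_eq`, `cl_le`, `decode`);
* **`Ctx.uniformAvg_scan_eq_run`** — the acceptance probability of the scan is the first-success value
  `FirstSucc.run (levels.map i ↦ (p y i, s y i 1)) ½` of `IndistinguishableFarEnsemblesMath.lean`;
  `Params.pr_dist_eq` — on the sparse set `D` accepts `⟨1ⁿ, z⟩` with exactly that probability;
* **`Ctx.abs_acc_sub_π1_mul_le`** — the per-image bound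
  `|acc y − π₁ y| · |fib y| ≤ 4 Σ_{i ≤ L} Fail(y,i) + (2^{1−g} + e^{−N}) |fib y|` (`g = eLen N − 1`,
  `T = N · 2^{g+2}` attempts per level), from `FirstSucc.abs_run_sub_le_exp` and the level estimates;
* the passage to samples `z`: `cnt`, `Zset`, `accSum`, `Ctx.toReal_acceptPMF_eq`, `Ctx.tvDist_eq`, and
  **`Ctx.sq_tvDist_sub_le_distAdvantage`**: `Δ(X n, Y n)² − 2 · errSum ≤ |Pr[D(Y n)=1] − Pr[D(X n)=1]|`.

## References

* O. Goldreich, *Foundations of Cryptography I*, CUP 2001, §3.8 Exercise 11 and Ch. 2 Exercise 17 (guidelines).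
* R. Impagliazzo, M. Luby, FOCS 1989, §4.
-/

namespace Literature.Computability.Cryptography

open Filter Finset Polynomial _root_.Computability Complexity AffineStr HILL

noncomputable section

namespace FarApartOWF

open scoped Classical

namespace Ctx

variable (C : Ctx)

/-! ### The scan -/

/-- The number of attempts per level, `T = N · 2^{eLen N + 1}` (`= N · 2^{g+2}`, `g = eLen N − 1`). [folklore] -/
def T : ℕ := C.N * 2 ^ (eLen C.N + 1)

/-- The length of the coin block of one attempt: key, target, `A`'s coins. [folklore] -/
def blk (kap : ℕ) : ℕ := C.klen + hLen C.N + kap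

/-- **One attempt** at level `i` on the image `y` with the coin block `b = ρ ‖ α ‖ r_A`: `some σ'` if the answer is
valid (its selector bit), `none` otherwise. [cite: Goldreich2001, Ch. 2 Exercise 17 (guideline)] -/
def att (kap : ℕ) (y : List Bool) (i : ℕ) (b : List Bool) : Option Bool :=
  if C.P.F (C.A.run (C.qry y i ((b.drop C.klen).take (hLen C.N)) (b.take C.klen)) ((b.drop (C.klen + hLen C.N)).take kap)) =
      body C.N y (C.ιb i) ((b.drop C.klen).take (hLen C.N)) (b.take C.klen) then
    some (C.outBit (C.A.run (C.qry y i ((b.drop C.klen).take (hLen C.N)) (b.take C.klen)) ((b.drop (C.klen + hLen C.N)).take kap)))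
  else none

/-- **The scan** along a list of levels: the bit of the first valid attempt, a fresh coin if all fail. [folklore] -/
def scan (kap : ℕ) (y : List Bool) : List ℕ → List Bool → Bool
  | [], r => r.getD 0 false
  | i :: is, r =>
    match C.att kap y i (r.take (C.blk kap)) with
    | some b => b
    | none => scan kap y is (r.drop (C.blk kap))

/-- The levels `lo + k − 1, …, lo`, each repeated `T` times, in decreasing order. [folklore] -/
def levelsGE (lo : ℕ) : ℕ → List ℕ
  | 0 => []
  | k + 1 => List.replicate C.T (lo + k) ++ levelsGE lo k

/-- **The schedule of the scan**: levels `L, L−1, …, 0`, `T` attempts each. [folklore] -/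
def levels : List ℕ := C.levelsGE 0 (C.L + 1)

/-- The slice image built by `D` from the sample `z` and the decoded coin counts: `bits l₀ ‖ bits l₁ ‖ enc z`. [folklore] -/
def yOf (l0 l1 : ℕ) (z : List Bool) : List Bool := Params.bitsT C.t l0 ++ Params.bitsT C.t l1 ++ C.P.enc C.n C.L z

/-- The output of `D` given the decoded advice `(m, l₀, l₁, kap)` (`m` is inside `C`). [folklore] -/
def dOut (l0 l1 kap : ℕ) (z r : List Bool) : Bool := C.scan kap (C.yOf l0 l1 z) C.levels r

/-! ### Elementary facts on the schedule -/

/-- `|levelsGE lo k| = k · T`. [folklore] -/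
theorem length_levelsGE (lo : ℕ) : ∀ k, (C.levelsGE lo k).length = k * C.T
  | 0 => by simp [levelsGE]
  | k + 1 => by rw [levelsGE, List.length_append, List.length_replicate, length_levelsGE lo k]; ring

/-- The levels in `levelsGE lo k` lie in `[lo, lo + k)`. [folklore] -/
theorem mem_levelsGE {lo : ℕ} : ∀ {k a : ℕ}, a ∈ C.levelsGE lo k → lo ≤ a ∧ a < lo + k
  | 0, a, h => by simp [levelsGE] at h
  | k + 1, a, h => by
    rw [levelsGE, List.mem_append, List.mem_replicate] at h
    rcases h with ⟨-, rfl⟩ | h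
    · omega
    · have := mem_levelsGE h; omega

/-- Splitting the schedule at a level `lo ≤ k`: the levels `≥ lo` come first. [folklore] -/
theorem levelsGE_split (lo : ℕ) : ∀ k, lo ≤ k → C.levelsGE 0 k = C.levelsGE lo (k - lo) ++ C.levelsGE 0 lo
  | 0, h => by have : lo = 0 := by omega
               subst this; rfl
  | k + 1, h => by
    rcases Nat.eq_or_lt_of_le h with rfl | hlt
    · simp [levelsGE]
    · rw [levelsGE, levelsGE_split lo k (by omega), Nat.succ_sub (by omega : lo ≤ k), levelsGE, List.append_assoc, zero_add,
        Nat.add_sub_cancel' (by omega : lo ≤ k)]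

/-- The sum of a nonnegative function along the schedule is at least `T` times its value at the lowest level.
[folklore] -/
theorem sum_map_levelsGE_ge (lo : ℕ) (x : ℕ → ℝ) (hx : ∀ a, 0 ≤ x a) : ∀ k, 1 ≤ k → C.T * x lo ≤ ((C.levelsGE lo k).map x).sum
  | 0, h => by omega
  | k + 1, _ => by
    rw [levelsGE, List.map_append, List.sum_append, List.map_replicate, List.sum_replicate, nsmul_eq_mul]
    rcases Nat.eq_zero_or_pos k with rfl | hk
    · simp [levelsGE]
    · have ih := sum_map_levelsGE_ge lo x hx k hk
      have : 0 ≤ (C.T : ℝ) * x (lo + k) := mul_nonneg (Nat.cast_nonneg _) (hx _)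
      linarith

/-! ### The scan reads a prefix of its coins -/

/-- **The scan reads only the first `|is| · blk + 1` coins.** [folklore] -/
theorem scan_take (kap : ℕ) (y : List Bool) : ∀ (is : List ℕ) (r : List Bool),
    C.scan kap y is (r.take (is.length * C.blk kap + 1)) = C.scan kap y is r
  | [], r => by cases r <;> simp [scan]
  | i :: is, r => by
    simp only [scan, List.length_cons]
    have h1 : (r.take ((is.length + 1) * C.blk kap + 1)).take (C.blk kap) = r.take (C.blk kap) := by
      rw [List.take_take, min_eq_left (by nlinarith)]
    have h2 : (r.take ((is.length + 1) * C.blk kap + 1)).drop (C.blk kap) = (r.drop (C.blk kap)).take (is.length * C.blk kap + 1) := by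
      rw [List.drop_take]; congr 1; ring_nf; omega
    rw [h1, h2, scan_take kap y is]

/-! ### The probability of one attempt -/

/-- The three-way split of a coin block: `E_b[g(ρ, α, r_A)] = E_ρ E_α E_{r_A}[g]`. [folklore] -/
theorem uniformAvg_blk (kap : ℕ) (g : List Bool → List Bool → List Bool → ℝ) :
    uniformAvg (C.blk kap) (fun b => g (b.take C.klen) ((b.drop C.klen).take (hLen C.N)) ((b.drop (C.klen + hLen C.N)).take kap)) =
      uniformAvg C.klen fun ρ => uniformAvg (hLen C.N) fun α => uniformAvg kap fun rA => g ρ α rA := by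
  unfold blk
  have e : ∀ b : List Bool, g (b.take C.klen) ((b.drop C.klen).take (hLen C.N)) ((b.drop (C.klen + hLen C.N)).take kap) =
      (fun ρ b' => g ρ (b'.take (hLen C.N)) ((b'.drop (hLen C.N)).take kap)) (b.take C.klen) (b.drop C.klen) := by
    intro b; simp only [List.drop_drop]
  rw [add_assoc, uniformAvg_congr (fun b _ => e b),
    uniformAvg_add C.klen (hLen C.N + kap) (fun ρ b' => g ρ (b'.take (hLen C.N)) ((b'.drop (hLen C.N)).take kap))]
  refine uniformAvg_congr fun ρ _ => ?_
  rw [uniformAvg_add (hLen C.N) kap (fun α b'' => g ρ α (b''.take kap))]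
  refine uniformAvg_congr fun α _ => uniformAvg_congr fun rA hrA => ?_
  rw [List.take_of_length_le hrA.le]

/-- **`Pr_b[att = some σ] = s y i σ`** (for `kap = κ`). [folklore] -/
theorem uniformAvg_att_some (y : List Bool) (i : ℕ) (σ : Bool) :
    uniformAvg (C.blk C.κ) (fun b => if C.att C.κ y i b = some σ then (1 : ℝ) else 0) = C.s y i σ := by
  unfold s
  rw [← C.uniformAvg_blk C.κ (fun ρ α rA => C.sInd y i σ α ρ rA)]
  refine uniformAvg_congr fun b _ => ?_
  unfold att sInd Valid ans
  split_ifs with h1 h2 h3 <;> simp_all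

/-- A uniform average of a sum. [folklore] -/
private theorem uniformAvg_add_distrib' (k : ℕ) (f g : List Bool → ℝ) :
    uniformAvg k (fun x => f x + g x) = uniformAvg k f + uniformAvg k g := by
  unfold uniformAvg; rw [Finset.sum_add_distrib, add_div]

/-- A uniform average of a difference. [folklore] -/
private theorem uniformAvg_sub_distrib' (k : ℕ) (f g : List Bool → ℝ) :
    uniformAvg k (fun x => f x - g x) = uniformAvg k f - uniformAvg k g := by
  unfold uniformAvg; rw [Finset.sum_sub_distrib, sub_div]

/-- `Pr_b[att = none] = 1 − p y i`. [folklore] -/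
theorem uniformAvg_att_none (y : List Bool) (i : ℕ) :
    uniformAvg (C.blk C.κ) (fun b => if C.att C.κ y i b = none then (1 : ℝ) else 0) = 1 - C.p y i := by
  have h : ∀ b : List Bool, (if C.att C.κ y i b = none then (1 : ℝ) else 0) =
      1 - ((if C.att C.κ y i b = some false then (1 : ℝ) else 0) + (if C.att C.κ y i b = some true then (1 : ℝ) else 0)) := by
    intro b
    rcases hb : C.att C.κ y i b with _ | ⟨_ | _⟩ <;> simp
  rw [uniformAvg_congr fun b _ => h b, uniformAvg_sub_distrib', uniformAvg_const, uniformAvg_add_distrib', C.uniformAvg_att_some,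
    C.uniformAvg_att_some]
  rfl

/-! ### The acceptance probability of the scan -/

/-- `E_{U_1} g = ½(g 0 + g 1)` (private copy of `uniformAvg_one`, `ComPRGHiding.lean`). [folklore] -/
private theorem uniformAvg_one' (g : List Bool → ℝ) : uniformAvg 1 g = 2⁻¹ * (g [false] + g [true]) := by
  show (∑ x : List.Vector Bool 1, g x.toList) / 2 ^ 1 = _
  have huniv : (Finset.univ : Finset (List.Vector Bool 1)) = {⟨[false], rfl⟩, ⟨[true], rfl⟩} := by
    ext v
    simp only [Finset.mem_univ, Finset.mem_insert, Finset.mem_singleton, true_iff]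
    obtain ⟨l, hl⟩ := v
    match l, hl with
    | [b], _ => cases b <;> simp
  rw [huniv, Finset.sum_pair (by decide)]
  simp only [List.Vector.toList_mk, pow_one]
  ring

/-- **The scan accepts with the first-success probability** of `IndistinguishableFarEnsemblesMath.lean`:
`Pr_r[scan levels r = 1] = FirstSucc.run (levels.map i ↦ (p y i, s y i 1)) ½` (coins of any length
`≥ |levels| · blk + 1`). [folklore] -/
theorem uniformAvg_scan_eq_run (y : List Bool) : ∀ (is : List ℕ) (e : ℕ),
    uniformAvg (is.length * C.blk C.κ + 1 + e) (fun r => if C.scan C.κ y is r = true then (1 : ℝ) else 0) =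
      FirstSucc.run (is.map fun i => (C.p y i, C.s y i true)) 2⁻¹
  | [], e => by
    simp only [List.length_nil, zero_mul, zero_add, List.map_nil, FirstSucc.run_nil, scan]
    rw [uniformAvg_congr (g := fun r => (fun u : List Bool => if u.getD 0 false = true then (1 : ℝ) else 0) (r.take 1))
      (fun r _ => by cases r <;> simp), uniformAvg_add 1 e (fun u _ => if u.getD 0 false = true then (1 : ℝ) else 0)]
    simp only [uniformAvg_const]
    rw [uniformAvg_one']
    simp
  | i :: is, e => by
    have hlen : (i :: is).length * C.blk C.κ + 1 + e = C.blk C.κ + (is.length * C.blk C.κ + 1 + e) := by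
      rw [List.length_cons]; ring
    rw [hlen]
    have ih := uniformAvg_scan_eq_run y is e
    set R := FirstSucc.run (is.map fun i => (C.p y i, C.s y i true)) 2⁻¹ with hR
    let φ : List Bool → List Bool → ℝ := fun b r' =>
      (C.att C.κ y i b).elim (if C.scan C.κ y is r' = true then 1 else 0) (fun bb => if bb = true then 1 else 0)
    have hkey : ∀ r : List Bool, (if C.scan C.κ y (i :: is) r = true then (1 : ℝ) else 0) = φ (r.take (C.blk C.κ)) (r.drop (C.blk C.κ)) := by
      intro r
      rcases h : C.att C.κ y i (r.take (C.blk C.κ)) with _ | bb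
      · simp [φ, scan, h]
      · simp [φ, scan, h]
    rw [uniformAvg_congr fun r _ => hkey r, uniformAvg_add (C.blk C.κ) _ φ]
    have hinner : ∀ b : List Bool, uniformAvg (is.length * C.blk C.κ + 1 + e) (fun r' => φ b r') =
        (if C.att C.κ y i b = some true then (1 : ℝ) else 0) + (if C.att C.κ y i b = none then (1 : ℝ) else 0) * R := by
      intro b
      simp only [φ]
      cases hb : C.att C.κ y i b with
      | none => simp only [Option.elim]; rw [ih]; simp
      | some bb => cases bb <;> simp [uniformAvg_const]
    rw [uniformAvg_congr fun b _ => hinner b, uniformAvg_add_distrib', C.uniformAvg_att_some, uniformAvg_mul_const, C.uniformAvg_att_none]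
    simp only [List.map_cons, FirstSucc.run_cons, hR]


/-! ### The per-image analysis of the scan -/

section PerImage

variable {C}
variable (h : C.WF) {y : List Bool} {u₀ : List.Vector Bool C.rl} (hy : C.P.ftil (C.xu u₀.toList) = y)
include h hy

omit h hy in
/-- The crowding exponent `g = eLen N − 1` (so `2^{-g} = 2 / 2^{eLen N} ≤ 1 / (8 N²)`). [folklore] -/
def gl : ℕ := eLen C.N - 1

omit h hy in
/-- **The acceptance probability of the scan on the image `y`**, as the first-success value. [folklore] -/
def acc (y : List Bool) : ℝ := FirstSucc.run (C.levels.map fun i => (C.p y i, C.s y i true)) 2⁻¹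

omit h hy in
/-- The total natural failure over the scanned levels, `FailSum y = Σ_{i ≤ L} Fail(y, i)`. [folklore] -/
def FailSum (y : List Bool) : ℝ := ∑ i ∈ Finset.range (C.L + 1), C.Fail y i

omit h hy in
/-- `eLen N = g + 1` and `g ≥ 2`. [folklore] -/
theorem gl_spec : eLen C.N = C.gl + 1 ∧ 2 ≤ C.gl := by unfold gl eLen; omega

omit h hy in
/-- `T = N · 2^{g+2}`. [folklore] -/
theorem T_eq : (C.T : ℝ) = C.N * 2 ^ (C.gl + 2) := by
  rw [T, C.gl_spec.1]; push_cast; ring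

omit h hy in
/-- `0 ≤ FailSum`. [folklore] -/
theorem FailSum_nonneg (y : List Bool) : 0 ≤ C.FailSum y := Finset.sum_nonneg fun i _ => C.Fail_nonneg y i

omit h hy in
/-- `Fail(y, i) ≤ FailSum y` for `i ≤ L`. [folklore] -/
theorem Fail_le_FailSum {i : ℕ} (hi : i ≤ C.L) (y : List Bool) : C.Fail y i ≤ C.FailSum y :=
  Finset.single_le_sum (f := fun i => C.Fail y i) (fun i _ => C.Fail_nonneg y i) (Finset.mem_range.2 (Nat.lt_succ_of_le hi))

omit h hy in
/-- `xl y (i + 1) = xl y i / 2`. [folklore] -/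
theorem xl_succ (y : List Bool) (i : ℕ) : C.xl y (i + 1) = C.xl y i / 2 := by
  unfold xl pfx; rw [show i + 1 + eLen C.N = (i + eLen C.N) + 1 by ring, pow_succ]; ring

omit h hy in
/-- `xl` is antitone in the level. [folklore] -/
theorem xl_le_of_le (y : List Bool) {i j : ℕ} (hij : i ≤ j) : C.xl y j ≤ C.xl y i := by
  unfold xl pfx
  exact div_le_div_of_nonneg_left (by positivity) (by positivity) (pow_le_pow_right₀ (by norm_num) (by omega))

omit h hy in
/-- `0 ≤ s ≤ p ≤ 1` at every level: the attempts are admissible for `FirstSucc`. [folklore] -/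
theorem f_adm (y : List Bool) (i : ℕ) : 0 ≤ C.s y i true ∧ C.s y i true ≤ C.p y i ∧ C.p y i ≤ 1 :=
  ⟨C.s_nonneg y i true, by unfold p; linarith [C.s_nonneg y i false], C.p_le_one y i⟩

omit h hy in
/-- `acc ∈ [0, 1]`. [folklore] -/
theorem acc_mem (y : List Bool) : 0 ≤ C.acc y ∧ C.acc y ≤ 1 :=
  FirstSucc.run_mem_Icc _ (fun a ha => by
    obtain ⟨i, -, rfl⟩ := List.mem_map.1 ha; exact C.f_adm y i) (by norm_num) (by norm_num)

omit h hy in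
/-- `zOfRest` and the selector only read the first `R n + 1` bits of the rest string. [folklore] -/
theorem zOfRest_eq_of_take_eq {u u' : List Bool} (n : ℕ) (he : u.take (C.P.R n + 1) = u'.take (C.P.R n + 1)) :
    Params.sgR u = Params.sgR u' ∧ C.P.zOfRest n u = C.P.zOfRest n u' := by
  have hsg : Params.sgR u = Params.sgR u' := by
    have := congrArg (fun l => l.getD 0 false) he
    simp only [List.getD_eq_getElem?_getD, List.getElem?_take, Nat.succ_pos, if_true] at this
    simpa [Params.sgR, List.getD_eq_getElem?_getD] using this
  have hco : (u.drop 1).take (C.P.R n) = (u'.drop 1).take (C.P.R n) := by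
    have e : ∀ w : List Bool, (w.drop 1).take (C.P.R n) = (w.take (C.P.R n + 1)).drop 1 := fun w => by
      rw [List.drop_take, Nat.add_sub_cancel]
    rw [e, e, he]
  refine ⟨hsg, ?_⟩
  unfold Params.zOfRest Params.coinsR
  rw [hsg, hco]

/-- **Every fibre has at least two elements** (flip the last, unused, bit of the rest string: `rl ≥ R + 2`).
[folklore] -/
theorem two_le_card_fib : 2 ≤ (C.fib y).card := by
  have hrl : C.P.R C.n + 2 ≤ C.rl := by have := C.P.fields_le h.served; unfold rl t n Params.R at *; omega
  set l := u₀.toList with hl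
  have hll : l.length = C.rl := u₀.toList_length
  -- flip the last bit
  set v := l.take (C.rl - 1) with hv
  set b := l.getD (C.rl - 1) false with hb
  have hvl : v.length = C.rl - 1 := by rw [hv, List.length_take, hll]; omega
  let u₁ : List.Vector Bool C.rl := ⟨v ++ [!b], by rw [List.length_append, hvl, List.length_singleton]; omega⟩
  have hne : u₁ ≠ u₀ := by
    intro he
    have h1 : (v ++ [!b]).getD (C.rl - 1) false = l.getD (C.rl - 1) false := by
      rw [show v ++ [!b] = u₁.toList from rfl, he]
    rw [List.getD_eq_getElem?_getD, List.getElem?_append_right (by rw [hvl]), hvl, Nat.sub_self] at h1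
    simp only [List.getElem?_cons_zero, Option.getD_some] at h1
    rw [← hb] at h1
    cases b <;> simp at h1
  have htk : (v ++ [!b]).take (C.P.R C.n + 1) = l.take (C.P.R C.n + 1) := by
    rw [List.take_append_of_le_length (by rw [hvl]; omega), hv, List.take_take, min_eq_left (by omega)]
  have hmem : u₁ ∈ C.fib y := by
    rw [mem_fib]
    show C.P.ftil (C.xu (v ++ [!b])) = y
    rw [h.ftil_xu (by rw [List.length_append, hvl, List.length_singleton]; omega), ← hy, h.ftil_xu u₀.toList_length,
      (C.zOfRest_eq_of_take_eq C.n htk).2]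
  have hmem₀ : u₀ ∈ C.fib y := C.mem_fib.2 hy
  calc 2 = ({u₁, u₀} : Finset _).card := by rw [Finset.card_pair hne]
    _ ≤ (C.fib y).card := Finset.card_le_card (by
        intro w hw
        rcases Finset.mem_insert.1 hw with rfl | hw
        · exact hmem
        · rw [Finset.mem_singleton.1 hw]; exact hmem₀)

omit h hy in
/-- At the full hash length the level ratio is small: `xl y L ≤ 2^{-g}`. [folklore] -/
theorem xl_L_le : C.xl y C.L ≤ 1 / 2 ^ C.gl := by
  have hcard : ((C.fib y).card : ℝ) ≤ 2 ^ C.rl := by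
    have := Finset.card_le_univ (C.fib y)
    rw [card_vector, Fintype.card_bool] at this
    exact_mod_cast this
  have hrl : C.rl ≤ C.L := by unfold rl; omega
  obtain ⟨hg, -⟩ := C.gl_spec
  unfold xl pfx
  rw [hg, div_le_div_iff₀ (by positivity) (by positivity), one_mul]
  calc ((C.fib y).card : ℝ) * 2 ^ C.gl ≤ 2 ^ C.rl * 2 ^ C.gl := by gcongr
    _ ≤ 2 ^ C.L * 2 ^ C.gl := by gcongr; norm_num
    _ ≤ 2 ^ (C.L + (C.gl + 1)) := by rw [pow_add, pow_succ]; nlinarith [pow_pos (two_pos (α := ℝ)) C.L, pow_pos (two_pos (α := ℝ)) C.gl]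

omit h hy in
/-- Some level has a small ratio (the full hash length does). [folklore] -/
theorem exists_xl_le (y : List Bool) : ∃ i, C.xl y i ≤ 1 / 2 ^ C.gl := ⟨C.L, C.xl_L_le⟩

omit h hy in
/-- **The stopping level** `i*`: the least level whose ratio is at most `2^{-g}`. [folklore] -/
def istar (y : List Bool) : ℕ := Nat.find (C.exists_xl_le y)

omit h hy in
/-- `xl y i* ≤ 2^{-g}`. [folklore] -/
theorem xl_istar_le : C.xl y (C.istar y) ≤ 1 / 2 ^ C.gl := Nat.find_spec (C.exists_xl_le y)

omit h hy in
/-- `i* ≤ L`. [folklore] -/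
theorem istar_le : C.istar y ≤ C.L := Nat.find_min' _ C.xl_L_le

/-- **`xl y i* ≥ 2^{-g-1}`** (at level `0` because the fibre has two elements, otherwise by minimality). [folklore] -/
theorem xl_istar_ge : 1 / 2 ^ (C.gl + 1) ≤ C.xl y (C.istar y) := by
  rcases Nat.eq_zero_or_pos (C.istar y) with h0 | hpos
  · rw [h0]
    obtain ⟨hg, -⟩ := C.gl_spec
    have h2 := C.two_le_card_fib h hy
    unfold xl pfx
    rw [zero_add, hg, div_le_div_iff₀ (by positivity) (by positivity), one_mul]
    have : (2 : ℝ) ≤ (C.fib y).card := by exact_mod_cast h2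
    have hp : (0 : ℝ) < 2 ^ (C.gl + 1) := by positivity
    nlinarith
  · have hmin : ¬ C.xl y (C.istar y - 1) ≤ 1 / 2 ^ C.gl := Nat.find_min (C.exists_xl_le y) (by unfold istar at hpos ⊢; omega)
    have hs : C.xl y (C.istar y) = C.xl y (C.istar y - 1) / 2 := by
      rw [← xl_succ]; congr 1; omega
    rw [hs, pow_succ]
    push Not at hmin
    rw [one_div, mul_inv, ← one_div, ← div_eq_mul_inv]
    linarith

/-- **The per-image bound, good case.** If `FailSum y ≤ |fib y| / 4` then
`|acc y − π₁ y| ≤ 2 (FailSum y / |fib y| + 2^{-g}) + e^{-N}`. [cite: Goldreich2001, Ch. 2 Exercise 17 (guideline: "the output distribution … deviates … by at most")] -/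
theorem abs_acc_sub_π1_le (hgood : C.FailSum y ≤ (C.fib y).card / 4) :
    |C.acc y - C.π1 y| ≤ 2 * (C.FailSum y / (C.fib y).card + 1 / 2 ^ C.gl) + Real.exp (-(C.N : ℝ)) := by
  have hNpos : (0 : ℝ) < (C.fib y).card := by exact_mod_cast lt_of_lt_of_le (by norm_num) (C.two_le_card_fib h hy)
  set θ : ℝ := C.FailSum y / (C.fib y).card + 1 / 2 ^ C.gl with hθ
  have hθ0 : 0 ≤ θ := by rw [hθ]; exact add_nonneg (div_nonneg (C.FailSum_nonneg y) hNpos.le) (by positivity)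
  obtain ⟨hq0, hq1⟩ := C.π1_mem hy
  have hist := C.istar_le (y := y)
  have hxs := C.xl_istar_le (y := y)
  have hg2 : (1 : ℝ) / 2 ^ C.gl ≤ 1 / 4 := by
    obtain ⟨-, hg⟩ := C.gl_spec
    rw [div_le_div_iff₀ (by positivity) (by positivity), one_mul, one_mul]
    calc (4 : ℝ) = 2 ^ 2 := by norm_num
      _ ≤ 2 ^ C.gl := pow_le_pow_right₀ (by norm_num) hg
  -- the split of the schedule at `i*`
  set as := C.levelsGE (C.istar y) (C.L + 1 - C.istar y) with has
  set f : ℕ → ℝ × ℝ := fun i => (C.p y i, C.s y i true) with hf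
  have hsplit : C.levels.map f = as.map f ++ (C.levelsGE 0 (C.istar y)).map f := by
    rw [levels, C.levelsGE_split (C.istar y) (C.L + 1) (by omega), List.map_append]
  have hmem : ∀ a ∈ as, C.istar y ≤ a ∧ a ≤ C.L := fun a ha => by
    have := C.mem_levelsGE ha; omega
  have hxa : ∀ a ∈ as, C.xl y a ≤ 1 / 2 ^ C.gl := fun a ha => (C.xl_le_of_le y (hmem a ha).1).trans hxs
  have hratio : ∀ a ∈ as, C.Fail y a / 2 ^ C.pfx a = C.xl y a * (C.Fail y a / (C.fib y).card) := fun a _ => by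
    unfold xl; field_simp
  have hFa : ∀ a ∈ as, C.Fail y a / (C.fib y).card ≤ C.FailSum y / (C.fib y).card := fun a ha =>
    div_le_div_of_nonneg_right (C.Fail_le_FailSum (hmem a ha).2 y) hNpos.le
  have hFS : C.FailSum y / (C.fib y).card ≤ 1 / 4 := by rw [div_le_iff₀ hNpos]; linarith
  have hmain := FirstSucc.abs_run_sub_le_exp f (fun i => C.xl y i) ((C.levelsGE 0 (C.istar y)).map f)
    (c := 2⁻¹) (π := C.π1 y) (θ := θ)
    (fun a ha => by obtain ⟨i, -, rfl⟩ := List.mem_map.1 ha; exact C.f_adm y i) (by norm_num) (by norm_num) hq0 hq1 hθ0 as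
    (fun a _ => C.f_adm y a)
    (fun a ha => ⟨C.xl_nonneg y a, (hxa a ha).trans (by linarith)⟩)
    (fun a ha => by
      have hb := h.abs_bias_le (hmem a ha).2 hy
      rw [hratio a ha] at hb
      refine hb.trans ?_
      rw [hθ, sq]
      have hx0 := C.xl_nonneg y a
      nlinarith [hFa a ha, hxa a ha, mul_le_mul_of_nonneg_left (hFa a ha) hx0, mul_le_mul_of_nonneg_left (hxa a ha) hx0])
    (fun a ha => by
      have hp := h.p_ge (hmem a ha).2 hy
      rw [hratio a ha] at hp
      have hx0 := C.xl_nonneg y a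
      have h1 : C.Fail y a / (C.fib y).card ≤ 1 / 4 := (hFa a ha).trans hFS
      have h2 : C.xl y a ≤ 1 / 4 := (hxa a ha).trans hg2
      nlinarith [mul_le_mul_of_nonneg_left h1 hx0, mul_le_mul_of_nonneg_left h2 hx0])
  -- the sum along the early levels
  have hsum : 2 * (C.N : ℝ) ≤ (as.map fun i => C.xl y i).sum := by
    have hk : 1 ≤ C.L + 1 - C.istar y := by omega
    have hge := C.sum_map_levelsGE_ge (C.istar y) (fun i => C.xl y i) (C.xl_nonneg y) _ hk
    have hxg := C.xl_istar_ge h hy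
    rw [C.T_eq] at hge
    have : (C.N : ℝ) * 2 ^ (C.gl + 2) * (1 / 2 ^ (C.gl + 1)) = 2 * C.N := by
      rw [pow_succ, pow_succ]; field_simp
    nlinarith [mul_le_mul_of_nonneg_left hxg (by positivity : (0 : ℝ) ≤ C.N * 2 ^ (C.gl + 2))]
  have hexp : Real.exp (-(as.map fun i => C.xl y i).sum / 2) ≤ Real.exp (-(C.N : ℝ)) := Real.exp_le_exp.2 (by linarith)
  unfold acc
  rw [hsplit]
  linarith

/-- **The per-image bound** (all images): `|acc y − π₁ y| · |fib y| ≤ 4 FailSum y + (2 / 2^g + e^{-N}) |fib y|`.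
[folklore] -/
theorem abs_acc_sub_π1_mul_le :
    |C.acc y - C.π1 y| * (C.fib y).card ≤ 4 * C.FailSum y + (2 / 2 ^ C.gl + Real.exp (-(C.N : ℝ))) * (C.fib y).card := by
  have hNpos : (0 : ℝ) < (C.fib y).card := by exact_mod_cast lt_of_lt_of_le (by norm_num) (C.two_le_card_fib h hy)
  have hFS := C.FailSum_nonneg y
  have he : 0 ≤ Real.exp (-(C.N : ℝ)) := (Real.exp_pos _).le
  have hg : (0 : ℝ) ≤ 2 / 2 ^ C.gl := by positivity
  by_cases hgood : C.FailSum y ≤ (C.fib y).card / 4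
  · have hb := C.abs_acc_sub_π1_le h hy hgood
    have := mul_le_mul_of_nonneg_right hb hNpos.le
    have e1 : (2 * (C.FailSum y / (C.fib y).card + 1 / 2 ^ C.gl) + Real.exp (-(C.N : ℝ))) * (C.fib y).card =
        2 * C.FailSum y + (2 / 2 ^ C.gl + Real.exp (-(C.N : ℝ))) * (C.fib y).card := by field_simp; ring
    nlinarith
  · push Not at hgood
    obtain ⟨ha0, ha1⟩ := C.acc_mem y
    obtain ⟨hq0, hq1⟩ := C.π1_mem hy
    have habs : |C.acc y - C.π1 y| ≤ 1 := by rw [abs_le]; constructor <;> linarith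
    calc |C.acc y - C.π1 y| * (C.fib y).card ≤ 1 * (C.fib y).card := mul_le_mul_of_nonneg_right habs hNpos.le
      _ ≤ 4 * C.FailSum y + (2 / 2 ^ C.gl + Real.exp (-(C.N : ℝ))) * (C.fib y).card := by nlinarith

end PerImage

/-! ### From images to samples: the sums over `z` -/

section Samples

variable {C}
variable (h : C.WF) (ho : ∀ (σ : Bool) (r : List Bool), r.length ≤ C.P.pc.eval C.n → ((C.P.S σ).run C.n r).length ≤ C.P.po.eval C.n)
include h ho

omit h ho in
/-- The sample of a rest string (as a vector). [folklore] -/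
def zR (u : List.Vector Bool C.rl) : List Bool := C.P.zOfRest C.n u.toList

omit h ho in
/-- **The set of all samples** of the two samplers at `n` (as reached from the rest space). [folklore] -/
def Zset : Finset (List Bool) := univ.image C.zR

omit h ho in
/-- The number of rest strings with selector `σ` and sample `z`. [folklore] -/
def cnt (σ : Bool) (z : List Bool) : ℕ := (univ.filter fun u : List.Vector Bool C.rl => Params.sgR u.toList = σ ∧ C.zR u = z).card

omit h ho in
/-- The number of rest strings with sample `z`. [folklore] -/
def cntAll (z : List Bool) : ℕ := (univ.filter fun u : List.Vector Bool C.rl => C.zR u = z).card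

omit h ho in
/-- **The image attached to a sample**: `yZ z = sp ‖ enc z` (what `D` builds from `z` with the true coin counts). [folklore] -/
def yZ (z : List Bool) : List Bool := C.sp ++ C.P.enc C.n C.L z

omit h ho in
/-- `yOf` with the true coin counts is `yZ`. [folklore] -/
theorem yOf_ell (z : List Bool) : C.yOf (C.P.ell false C.n) (C.P.ell true C.n) z = C.yZ z := by
  rw [yOf, yZ, sp, Params.slicePref, t]

omit ho in
/-- `f̃(sp ‖ u) = yZ (zR u)`. [folklore] -/
theorem ftil_xu_eq_yZ (u : List.Vector Bool C.rl) : C.P.ftil (C.xu u.toList) = C.yZ (C.zR u) := by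
  rw [h.ftil_xu u.toList_length, yZ, zR]

omit h in
/-- Samples are short: `|zR u| ≤ po n`. [folklore] -/
theorem length_zR_le (u : List.Vector Bool C.rl) : (C.zR u).length ≤ C.P.po.eval C.n := by
  unfold zR Params.zOfRest
  refine ho _ _ ?_
  rw [Params.coinsR, List.length_take, List.length_take]
  exact (min_le_right _ _).trans ((min_le_left _ _).trans le_rfl)

/-- The cap is inactive on samples: `2 |zR u| + 2 ≤ W`. [folklore] -/
theorem two_mul_length_zR_le (u : List.Vector Bool C.rl) : 2 * (C.zR u).length + 2 ≤ C.P.W C.n C.L := by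
  have h1 := C.length_zR_le ho u
  have h2 : 2 * C.P.tLen C.n + (2 * C.P.po.eval C.n + 4) ≤ C.L := (C.P.code_le_Q C.n).trans h.served
  show 2 * (C.zR u).length + 2 ≤ C.L - 2 * C.P.tLen C.n
  omega

/-- **The fibre of `yZ (zR u₁)` is the set of rest strings with the same sample.** [folklore] -/
theorem fib_yZ (u₁ : List.Vector Bool C.rl) : C.fib (C.yZ (C.zR u₁)) = univ.filter fun u => C.zR u = C.zR u₁ := by
  ext u
  rw [mem_fib, Finset.mem_filter, C.ftil_xu_eq_yZ h u, yZ, yZ]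
  simp only [Finset.mem_univ, true_and]
  rw [List.append_right_inj, Params.enc_injective_iff, C.P.take_cap_eq (C.two_mul_length_zR_le h ho u),
    C.P.take_cap_eq (C.two_mul_length_zR_le h ho u₁)]

/-- Hence `|fib (yZ z)| = cntAll z` on samples. [folklore] -/
theorem card_fib_yZ (u₁ : List.Vector Bool C.rl) : (C.fib (C.yZ (C.zR u₁))).card = C.cntAll (C.zR u₁) := by
  rw [C.fib_yZ h ho, cntAll]

/-- And `|fibB (yZ z) σ| = cnt σ z`. [folklore] -/
theorem card_fibB_yZ (u₁ : List.Vector Bool C.rl) (σ : Bool) : (C.fibB (C.yZ (C.zR u₁)) σ).card = C.cnt σ (C.zR u₁) := by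
  rw [fibB, C.fib_yZ h ho, cnt, Finset.filter_filter]
  congr 1
  exact Finset.filter_congr fun u _ => by tauto

omit h ho in
/-- `cnt 0 + cnt 1 = cntAll`. [folklore] -/
theorem cnt_add (z : List Bool) : C.cnt false z + C.cnt true z = C.cntAll z := by
  unfold cnt cntAll
  rw [← Finset.card_union_of_disjoint]
  · congr 1; ext u; simp only [Finset.mem_union, Finset.mem_filter, Finset.mem_univ, true_and]
    cases Params.sgR u.toList <;> simp
  · rw [Finset.disjoint_filter]; intro u _ h1 h2; rw [h1.1] at h2; exact Bool.false_ne_true h2.1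

omit h ho in
/-- Members of `Zset` have positive `cntAll`. [folklore] -/
theorem cntAll_pos {z : List Bool} (hz : z ∈ C.Zset) : 0 < C.cntAll z := by
  obtain ⟨u, -, rfl⟩ := Finset.mem_image.1 hz
  exact Finset.card_pos.2 ⟨u, by simp⟩

omit h ho in
/-- `cnt σ z = 0` off `Zset`. [folklore] -/
theorem cnt_eq_zero {z : List Bool} (hz : z ∉ C.Zset) (σ : Bool) : C.cnt σ z = 0 := by
  rw [cnt, Finset.card_eq_zero, Finset.filter_eq_empty_iff]
  intro u _ hu
  exact hz (Finset.mem_image.2 ⟨u, Finset.mem_univ _, hu.2⟩)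

omit ho in
/-- **The slice sum**: for every `φ`,
`E_{r ← U_{ℓ_σ(n)}}[φ(S_σ(1ⁿ; r))] = (2 / 2^{rl}) Σ_{z ∈ Zset} cnt σ z · φ z`. [folklore] -/
theorem uniformAvg_ell_eq_sum (σ : Bool) (φ : List Bool → ℝ) :
    uniformAvg (C.P.ell σ C.n) (fun r => φ ((C.P.S σ).run C.n r)) = 2 / 2 ^ C.rl * ∑ z ∈ C.Zset, C.cnt σ z * φ z := by
  have hrl : C.P.R C.n + 2 ≤ C.rl := by have := C.P.fields_le h.served; unfold rl t n Params.R at *; omega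
  obtain ⟨J, hJ⟩ : ∃ J, C.rl = 1 + (C.P.R C.n + J) := ⟨C.rl - 1 - C.P.R C.n, by omega⟩
  have hsl := C.P.uniformAvg_slice h.coin σ J φ
  rw [← hJ] at hsl
  -- the left-hand side of the slice identity as a sum over `z`
  have hL : uniformAvg C.rl (fun rest => (if Params.sgR rest = σ then (1 : ℝ) else 0) * φ (C.P.zOfRest C.n rest)) =
      (∑ z ∈ C.Zset, C.cnt σ z * φ z) / 2 ^ C.rl := by
    unfold uniformAvg
    congr 1
    rw [← Finset.sum_fiberwise_of_maps_to (g := C.zR) (t := C.Zset) (fun u _ => Finset.mem_image_of_mem _ (Finset.mem_univ u))]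
    refine Finset.sum_congr rfl fun z _ => ?_
    rw [cnt, Finset.card_eq_sum_ones, Nat.cast_sum, Finset.sum_mul]
    simp only [Nat.cast_one, one_mul]
    rw [← Finset.sum_filter_add_sum_filter_not (s := univ.filter fun u => C.zR u = z) (fun u => Params.sgR u.toList = σ)]
    have h0 : ∑ u ∈ (univ.filter fun u => C.zR u = z).filter (fun u => ¬ Params.sgR u.toList = σ),
        (if Params.sgR u.toList = σ then (1 : ℝ) else 0) * φ (C.P.zOfRest C.n u.toList) = 0 :=
      Finset.sum_eq_zero fun u hu => by rw [if_neg (Finset.mem_filter.1 hu).2, zero_mul]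
    rw [h0, add_zero, Finset.filter_filter]
    refine Finset.sum_congr (Finset.filter_congr fun u _ => by tauto) fun u hu => ?_
    obtain ⟨h1, h2⟩ := (Finset.mem_filter.1 hu).2
    rw [if_pos h1, one_mul, ← h2]; rfl
  rw [hL] at hsl
  have h2 : (2 : ℝ) ^ C.rl ≠ 0 := by positivity
  field_simp at hsl ⊢
  linarith

omit h ho in
/-- `uniformProb` as a uniform average of an indicator (private copy). [folklore] -/
private theorem uniformProb_eq_uniformAvg' (m : ℕ) (E : Set (List Bool)) [DecidablePred (· ∈ E)] :
    uniformProb m E = uniformAvg m (fun s => if s ∈ E then 1 else 0) := by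
  classical
  unfold uniformProb uniformAvg
  rw [Finset.sum_boole]
  congr

omit h ho in
/-- **The point masses of a sampler's output law**: `Pr[S_σ(1ⁿ) = z] = E_r[[S_σ(1ⁿ; r) = z]]`. [folklore] -/
theorem toReal_outputPMF_apply (σ : Bool) (z : List Bool) :
    (((C.P.S σ).outputPMF unaryEncodeNat C.n) z).toReal =
      uniformAvg (C.P.ell σ C.n) (fun r => if (C.P.S σ).run C.n r = z then (1 : ℝ) else 0) := by
  rw [Params.outputPMF_unary_eq, ← PMF.toOuterMeasure_apply_singleton, PMF.toOuterMeasure_map_apply, uniformBits,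
    PMF.toOuterMeasure_map_apply,
    show (List.Vector.toList ⁻¹' ((C.P.S σ).run C.n ⁻¹' {z}) : Set (List.Vector Bool ((C.P.S σ).coinLen C.n))) =
      {r | r.toList ∈ {r' : List Bool | (C.P.S σ).run C.n r' = z}} from rfl,
    ← uniformProb_eq_toOuterMeasure, uniformProb_eq_uniformAvg']
  exact uniformAvg_congr fun r _ => if_congr Iff.rfl rfl rfl

omit ho in
/-- **The point masses as counts**: `Pr[S_σ(1ⁿ) = z] = 2 cnt σ z / 2^{rl}`. [folklore] -/
theorem toReal_outputPMF_eq_cnt (σ : Bool) (z : List Bool) :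
    (((C.P.S σ).outputPMF unaryEncodeNat C.n) z).toReal = 2 * C.cnt σ z / 2 ^ C.rl := by
  rw [C.toReal_outputPMF_apply, C.uniformAvg_ell_eq_sum h σ (fun z' => if z' = z then (1 : ℝ) else 0)]
  by_cases hz : z ∈ C.Zset
  · rw [Finset.sum_eq_single_of_mem z hz (fun z' _ hne => by rw [if_neg hne, mul_zero]), if_pos rfl]; ring
  · rw [Finset.sum_eq_zero (fun z' hz' => by rw [if_neg (fun he => hz (by rwa [he] at hz')), mul_zero]), C.cnt_eq_zero hz]; simp

omit ho in
/-- **The statistical distance as a finite sum**: `Δ(S₀(1ⁿ), S₁(1ⁿ)) = Σ_{z ∈ Zset} |cnt 1 z − cnt 0 z| / 2^{rl}`. [folklore] -/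
theorem tvDist_eq :
    (C.P.S0.outputPMF unaryEncodeNat C.n).tvDist (C.P.S1.outputPMF unaryEncodeNat C.n) =
      ∑ z ∈ C.Zset, |(C.cnt true z : ℝ) - C.cnt false z| / 2 ^ C.rl := by
  unfold PMF.tvDist
  have h0 := C.toReal_outputPMF_eq_cnt h false
  have h1 := C.toReal_outputPMF_eq_cnt h true
  simp only [Params.S_false, Params.S_true] at h0 h1
  rw [tsum_eq_sum (s := C.Zset) (fun z hz => by rw [h0, h1, C.cnt_eq_zero hz, C.cnt_eq_zero hz]; simp)]
  rw [Finset.mul_sum]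
  refine Finset.sum_congr rfl fun z _ => ?_
  rw [h0, h1, ← sub_div, abs_div, abs_of_pos (by positivity : (0 : ℝ) < 2 ^ C.rl)]
  rw [show (2 : ℝ) * C.cnt false z - 2 * C.cnt true z = 2 * ((C.cnt false z : ℝ) - C.cnt true z) by ring, abs_mul,
    abs_two, abs_sub_comm]
  ring

omit ho in
/-- Flipping the first bit matches the two selector halves of the rest space. [folklore] -/
theorem card_sgR_eq : (univ.filter fun u : List.Vector Bool C.rl => Params.sgR u.toList = false).card =
    (univ.filter fun u : List.Vector Bool C.rl => Params.sgR u.toList = true).card := by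
  refine Finset.card_bij (fun u _ => ⟨u.toList.modifyHead (!·), by simp⟩) ?_ ?_ ?_
  · intro u hu
    simp only [Finset.mem_filter, Finset.mem_univ, true_and] at hu ⊢
    obtain ⟨l, hl⟩ := u
    cases l with
    | nil => exfalso; have := h.rl_pos; simp at hl; omega
    | cons b l => simp only [Params.sgR, List.Vector.toList_mk, List.getD_cons_zero] at hu ⊢; simp [hu]
  · intro u _ u' _ he
    have := congrArg List.Vector.toList he
    simp only [List.Vector.toList_mk] at this
    apply List.Vector.toList_injective
    obtain ⟨l, hl⟩ := u; obtain ⟨l', hl'⟩ := u'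
    cases l with
    | nil => cases l' with
      | nil => rfl
      | cons b' l' => simp at this
    | cons b l => cases l' with
      | nil => simp at this
      | cons b' l' =>
        simp only [List.Vector.toList_mk, List.modifyHead_cons, List.cons.injEq] at this ⊢
        exact ⟨by cases b <;> cases b' <;> simp_all, this.2⟩
  · intro u hu
    simp only [Finset.mem_filter, Finset.mem_univ, true_and] at hu
    refine ⟨⟨u.toList.modifyHead (!·), by simp⟩, ?_, ?_⟩
    · simp only [Finset.mem_filter, Finset.mem_univ, true_and]
      obtain ⟨l, hl⟩ := u
      cases l with
      | nil => exfalso; have := h.rl_pos; simp at hl; omega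
      | cons b l => simp only [Params.sgR, List.Vector.toList_mk, List.getD_cons_zero] at hu ⊢; simp [hu]
    · apply List.Vector.toList_injective
      obtain ⟨l, hl⟩ := u
      cases l with
      | nil => rfl
      | cons b l => simp

omit h ho in
/-- `Σ_z cnt σ z = #{u : sgR u = σ}`. [folklore] -/
theorem sum_cnt (σ : Bool) : ∑ z ∈ C.Zset, (C.cnt σ z : ℝ) = (univ.filter fun u : List.Vector Bool C.rl => Params.sgR u.toList = σ).card := by
  rw [Finset.card_eq_sum_card_fiberwise (f := C.zR) (t := C.Zset) (fun u _ => Finset.mem_image_of_mem _ (Finset.mem_univ u)),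
    Nat.cast_sum]
  refine Finset.sum_congr rfl fun z _ => ?_
  rw [cnt, Finset.filter_filter]

omit h ho in
/-- `Σ_z cntAll z = 2^{rl}`. [folklore] -/
theorem sum_cntAll : ∑ z ∈ C.Zset, (C.cntAll z : ℝ) = 2 ^ C.rl := by
  have := Finset.card_eq_sum_card_fiberwise (f := C.zR) (s := (univ : Finset (List.Vector Bool C.rl))) (t := C.Zset)
    (fun u _ => Finset.mem_image_of_mem _ (Finset.mem_univ u))
  rw [Finset.card_univ, card_vector, Fintype.card_bool] at this
  have h2 : ((2 ^ C.rl : ℕ) : ℝ) = ∑ z ∈ C.Zset, (C.cntAll z : ℝ) := by rw [this, Nat.cast_sum]; rfl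
  exact_mod_cast h2.symm

/-- **The `Δ²` bound for the two samplers**: `Δ² ≤ 2 Σ_{z ∈ Zset} (cnt 1 z − cnt 0 z)/2^{rl} · π₁(yZ z)`.
[folklore] -/
theorem sq_tvDist_le :
    ((C.P.S0.outputPMF unaryEncodeNat C.n).tvDist (C.P.S1.outputPMF unaryEncodeNat C.n)) ^ 2 ≤
      2 * ∑ z ∈ C.Zset, ((C.cnt true z : ℝ) - C.cnt false z) / 2 ^ C.rl * C.π1 (C.yZ z) := by
  rw [C.tvDist_eq h]
  have hp : ∀ z ∈ C.Zset, (0 : ℝ) ≤ C.cnt false z / 2 ^ C.rl := fun _ _ => by positivity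
  have hq : ∀ z ∈ C.Zset, (0 : ℝ) ≤ C.cnt true z / 2 ^ C.rl := fun _ _ => by positivity
  have hsum : ∑ z ∈ C.Zset, (C.cnt false z : ℝ) / 2 ^ C.rl = ∑ z ∈ C.Zset, (C.cnt true z : ℝ) / 2 ^ C.rl := by
    rw [← Finset.sum_div, ← Finset.sum_div, C.sum_cnt, C.sum_cnt, C.card_sgR_eq h]
  have hcs := sq_sum_abs_sub_le C.Zset (fun z => (C.cnt false z : ℝ) / 2 ^ C.rl) (fun z => (C.cnt true z : ℝ) / 2 ^ C.rl) hp hq hsum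
  have htot : ∑ z ∈ C.Zset, ((C.cnt false z : ℝ) / 2 ^ C.rl + C.cnt true z / 2 ^ C.rl) = 1 := by
    calc ∑ z ∈ C.Zset, ((C.cnt false z : ℝ) / 2 ^ C.rl + C.cnt true z / 2 ^ C.rl)
        = (∑ z ∈ C.Zset, (C.cntAll z : ℝ)) / 2 ^ C.rl := by
          rw [Finset.sum_div]
          refine Finset.sum_congr rfl fun z _ => ?_
          rw [← C.cnt_add z]; push_cast; ring
      _ = 1 := by rw [C.sum_cntAll, div_self (by positivity)]
  rw [htot, mul_one] at hcs
  have habs : ∑ z ∈ C.Zset, |(C.cnt true z : ℝ) - C.cnt false z| / 2 ^ C.rl =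
      ∑ z ∈ C.Zset, |(C.cnt true z : ℝ) / 2 ^ C.rl - C.cnt false z / 2 ^ C.rl| := by
    refine Finset.sum_congr rfl fun z _ => ?_
    rw [← sub_div, abs_div, abs_of_pos (by positivity : (0 : ℝ) < 2 ^ C.rl)]
  rw [habs]
  refine hcs.trans (le_of_eq ?_)
  congr 1
  refine Finset.sum_congr rfl fun z hz => ?_
  obtain ⟨u₁, -, rfl⟩ := Finset.mem_image.1 hz
  have hpos : (0 : ℝ) < C.cntAll (C.zR u₁) := by exact_mod_cast C.cntAll_pos hz
  rw [π1, C.card_fibB_yZ h ho, C.card_fib_yZ h ho, ← sub_div]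
  have hc : ((C.cnt false (C.zR u₁) : ℝ) / 2 ^ C.rl + C.cnt true (C.zR u₁) / 2 ^ C.rl) = C.cntAll (C.zR u₁) / 2 ^ C.rl := by
    rw [← C.cnt_add]; push_cast; ring
  rw [hc]
  field_simp

/-- **The advantage bound at one length, for an abstract acceptance function `φ` that equals `acc (yZ z)` on samples**:
`Δ² − (8/2^{rl}) Σ_z FailSum(yZ z) − 2 (2/2^g + e^{−N}) ≤ |E_{Y n}[φ] − E_{X n}[φ]|`.
[cite: Goldreich2001, §3.8 Exercise 11 (guideline: "a distributional one-way function", the distinguisher from a distributional inverter)] -/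
theorem sq_tvDist_sub_le_abs (φ : List Bool → ℝ) (hφ : ∀ u : List.Vector Bool C.rl, φ (C.zR u) = C.acc (C.yZ (C.zR u))) :
    ((C.P.S0.outputPMF unaryEncodeNat C.n).tvDist (C.P.S1.outputPMF unaryEncodeNat C.n)) ^ 2 -
        8 / 2 ^ C.rl * ∑ z ∈ C.Zset, C.FailSum (C.yZ z) - 2 * (2 / 2 ^ C.gl + Real.exp (-(C.N : ℝ))) ≤
      |uniformAvg (C.P.ell true C.n) (fun r => φ (C.P.S1.run C.n r)) - uniformAvg (C.P.ell false C.n) (fun r => φ (C.P.S0.run C.n r))| := by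
  have e0 := C.uniformAvg_ell_eq_sum h false φ
  have e1 := C.uniformAvg_ell_eq_sum h true φ
  simp only [Params.S_false, Params.S_true] at e0 e1
  rw [e0, e1, ← mul_sub, ← Finset.sum_sub_distrib, abs_mul, abs_of_pos (by positivity : (0 : ℝ) < 2 / 2 ^ C.rl)]
  have hsq := C.sq_tvDist_le h ho
  set Δ := (C.P.S0.outputPMF unaryEncodeNat C.n).tvDist (C.P.S1.outputPMF unaryEncodeNat C.n) with hΔ
  set ε₀ : ℝ := 2 / 2 ^ C.gl + Real.exp (-(C.N : ℝ)) with hε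
  -- per sample: `(q − p) acc ≥ (q − p) π₁ − (p + q) |acc − π₁|` and the per-image bound
  have hz : ∀ z ∈ C.Zset, ((C.cnt true z : ℝ) - C.cnt false z) * C.π1 (C.yZ z) - (4 * C.FailSum (C.yZ z) + ε₀ * C.cntAll z) ≤
      (C.cnt true z : ℝ) * φ z - C.cnt false z * φ z := by
    intro z hz
    obtain ⟨u₁, -, rfl⟩ := Finset.mem_image.1 hz
    have hb := C.abs_acc_sub_π1_mul_le h (C.ftil_xu_eq_yZ h u₁)
    rw [C.card_fib_yZ h ho] at hb
    rw [hφ u₁]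
    have hc : ((C.cnt false (C.zR u₁) : ℝ)) + C.cnt true (C.zR u₁) = C.cntAll (C.zR u₁) := by exact_mod_cast C.cnt_add _
    have habs : |((C.cnt true (C.zR u₁) : ℝ) - C.cnt false (C.zR u₁))| ≤ C.cntAll (C.zR u₁) := by
      rw [← hc, abs_le]; constructor <;> nlinarith [Nat.cast_nonneg (α := ℝ) (C.cnt false (C.zR u₁)), Nat.cast_nonneg (α := ℝ) (C.cnt true (C.zR u₁))]
    have key : ((C.cnt true (C.zR u₁) : ℝ) - C.cnt false (C.zR u₁)) * (C.π1 (C.yZ (C.zR u₁)) - C.acc (C.yZ (C.zR u₁))) ≤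
        |C.acc (C.yZ (C.zR u₁)) - C.π1 (C.yZ (C.zR u₁))| * C.cntAll (C.zR u₁) := by
      calc ((C.cnt true (C.zR u₁) : ℝ) - C.cnt false (C.zR u₁)) * (C.π1 (C.yZ (C.zR u₁)) - C.acc (C.yZ (C.zR u₁)))
          ≤ |((C.cnt true (C.zR u₁) : ℝ) - C.cnt false (C.zR u₁)) * (C.π1 (C.yZ (C.zR u₁)) - C.acc (C.yZ (C.zR u₁)))| := le_abs_self _
        _ = |((C.cnt true (C.zR u₁) : ℝ) - C.cnt false (C.zR u₁))| * |C.acc (C.yZ (C.zR u₁)) - C.π1 (C.yZ (C.zR u₁))| := by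
            rw [abs_mul, abs_sub_comm (C.π1 _)]
        _ ≤ C.cntAll (C.zR u₁) * |C.acc (C.yZ (C.zR u₁)) - C.π1 (C.yZ (C.zR u₁))| := mul_le_mul_of_nonneg_right habs (abs_nonneg _)
        _ = _ := mul_comm _ _
    nlinarith
  have hsumz := Finset.sum_le_sum hz
  rw [Finset.sum_sub_distrib, Finset.sum_add_distrib, ← Finset.mul_sum, ← Finset.mul_sum, C.sum_cntAll] at hsumz
  -- `Δ² ≤ (2/2^rl) Σ (q−p) π₁ · 2^{rl}`… assemble
  have hΔ2 : Δ ^ 2 ≤ 2 / 2 ^ C.rl * ∑ z ∈ C.Zset, ((C.cnt true z : ℝ) - C.cnt false z) * C.π1 (C.yZ z) := by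
    refine hsq.trans (le_of_eq ?_)
    rw [Finset.mul_sum, Finset.mul_sum]
    refine Finset.sum_congr rfl fun z _ => ?_
    ring
  have hpow : (0 : ℝ) < 2 ^ C.rl := by positivity
  calc Δ ^ 2 - 8 / 2 ^ C.rl * ∑ z ∈ C.Zset, C.FailSum (C.yZ z) - 2 * ε₀
      ≤ 2 / 2 ^ C.rl * (∑ z ∈ C.Zset, ((C.cnt true z : ℝ) * φ z - C.cnt false z * φ z)) := by
        have : 2 / 2 ^ C.rl * (∑ z ∈ C.Zset, ((C.cnt true z : ℝ) - C.cnt false z) * C.π1 (C.yZ z)) -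
            2 / 2 ^ C.rl * (4 * ∑ z ∈ C.Zset, C.FailSum (C.yZ z) + ε₀ * 2 ^ C.rl) ≤
            2 / 2 ^ C.rl * ∑ z ∈ C.Zset, ((C.cnt true z : ℝ) * φ z - C.cnt false z * φ z) := by
          rw [← mul_sub]; exact mul_le_mul_of_nonneg_left (by linarith) (by positivity)
        have e2 : 2 / 2 ^ C.rl * (4 * ∑ z ∈ C.Zset, C.FailSum (C.yZ z) + ε₀ * 2 ^ C.rl) =
            8 / 2 ^ C.rl * ∑ z ∈ C.Zset, C.FailSum (C.yZ z) + 2 * ε₀ := by field_simp; ring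
        linarith
    _ ≤ 2 / 2 ^ C.rl * |∑ z ∈ C.Zset, ((C.cnt true z : ℝ) * φ z - C.cnt false z * φ z)| :=
        mul_le_mul_of_nonneg_left (le_abs_self _) (by positivity)

/-! ### The natural failure over the slice and the inverter's success -/

omit h ho in
/-- `sliceFail i = E_u[1 − nat u i]`, the natural failure rate of `A` on the slice at level `i`. [folklore] -/
def sliceFail (i : ℕ) : ℝ := uniformAvg C.rl fun u => 1 - C.nat u i

/-- **`Σ_{z ∈ Zset} FailSum (yZ z) = 2^{rl} Σ_{i ≤ L} sliceFail i`** (the fibres partition the rest space). [folklore] -/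
theorem sum_FailSum_eq : ∑ z ∈ C.Zset, C.FailSum (C.yZ z) = 2 ^ C.rl * ∑ i ∈ Finset.range (C.L + 1), C.sliceFail i := by
  unfold FailSum
  rw [Finset.sum_comm, Finset.mul_sum]
  refine Finset.sum_congr rfl fun i _ => ?_
  unfold Fail sliceFail uniformAvg
  rw [mul_div_cancel₀ _ (by positivity : (2 : ℝ) ^ C.rl ≠ 0)]
  rw [← Finset.sum_fiberwise_of_maps_to (s := (univ : Finset (List.Vector Bool C.rl))) (g := C.zR) (t := C.Zset)
    (fun u _ => Finset.mem_image_of_mem _ (Finset.mem_univ u))]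
  refine Finset.sum_congr rfl fun z hz => ?_
  obtain ⟨u₁, -, rfl⟩ := Finset.mem_image.1 hz
  rw [C.fib_yZ h ho u₁]

omit h ho in
/-- One term of a nonnegative average (private copy of `single_le_uniformAvg`, `CommitmentOneWay.lean`). [folklore] -/
private theorem single_le_uniformAvg' {k : ℕ} (Φ : List Bool → ℝ) (hΦ : ∀ u : List Bool, u.length = k → 0 ≤ Φ u)
    {u₀ : List Bool} (hu₀ : u₀.length = k) : Φ u₀ / 2 ^ k ≤ uniformAvg k Φ := by
  unfold uniformAvg
  have hsum : Φ u₀ ≤ ∑ v : List.Vector Bool k, Φ v.toList :=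
    Finset.single_le_sum (s := Finset.univ) (f := fun v : List.Vector Bool k => Φ v.toList)
      (fun v _ => hΦ _ (by simp)) (Finset.mem_univ (α := List.Vector Bool k) ⟨u₀, hu₀⟩)
  exact div_le_div_of_nonneg_right hsum (by positivity)

omit h ho in
/-- Reading `{0,1}^{a+b}` as a prefix and a suffix (private copy of `uniformAvg_split`). [folklore] -/
private theorem uniformAvg_split' (a b : ℕ) (g : List Bool → ℝ) :
    uniformAvg (a + b) g = uniformAvg a (fun u => uniformAvg b (fun w => g (u ++ w))) := by
  rw [← uniformAvg_add a b (fun u w => g (u ++ w))]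
  exact uniformAvg_congr fun x _ => by rw [List.take_append_drop]

omit ho in
/-- **`nat u i` is the inverter's success on the genuine input**: the integrand of `invertProb F A m` at
`v = sp ‖ u ‖ ι_i ‖ ρ`, averaged over `ρ`. [folklore] -/
theorem pr_eq_nat_integrand {u ρ : List Bool} (hu : u.length = C.rl) (hρ : ρ.length = C.klen) {i : ℕ} (hi : i ≤ C.L) :
    C.A.pr id (boolPair (unaryEncodeNat C.m) (C.P.F (C.xu u ++ C.ιb i ++ ρ))) {w | C.P.F w = C.P.F (C.xu u ++ C.ιb i ++ ρ)} =
      uniformAvg C.κ (fun rA => if C.Inverts u i ρ rA then (1 : ℝ) else 0) := by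
  have hv : (C.xu u ++ C.ιb i ++ ρ).length = C.m := by
    rw [List.length_append, List.length_append, h.length_xu hu, h.length_ιb hi, hρ, h.L_add_il, h.klen_eq]
  rw [RandAlg.pr_eq_uniformProb, id, C.length_pair_F hv, uniformProb_eq_uniformAvg']
  refine uniformAvg_congr fun rA _ => if_congr ?_ rfl rfl
  rw [Set.mem_setOf_eq, Set.mem_setOf_eq, Inverts, h.natQ_eq hu hρ hi]

omit ho in
/-- **The slice/level density bound**: `sliceFail i ≤ 2^{2t} · 2^{il} · (1 − invertProb F A m)` for `i ≤ L`
(the inputs `sp ‖ u ‖ ι_i ‖ ρ` are a `2^{-2t-il}` fraction of `{0,1}^m`). [folklore] -/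
theorem sliceFail_le {i : ℕ} (hi : i ≤ C.L) :
    C.sliceFail i ≤ 2 ^ (2 * C.t) * 2 ^ C.il * (1 - invertProb C.P.F C.A C.m) := by
  -- the integrand of `1 − invertProb`
  set g : List Bool → ℝ := fun v => 1 - C.A.pr id (boolPair (unaryEncodeNat C.m) (C.P.F v)) {w | C.P.F w = C.P.F v} with hg
  have hg0 : ∀ v, 0 ≤ g v := fun v => sub_nonneg.2 (RandAlg.pr_le_one _ _ _ _)
  have hm : C.m = 2 * C.t + (C.rl + (C.il + C.klen)) := by
    have := h.rl_eq; have := h.L_add_il; have := h.klen_eq; omega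
  have hinv : 1 - invertProb C.P.F C.A C.m = uniformAvg (2 * C.t) (fun a => uniformAvg C.rl (fun u => uniformAvg C.il (fun ι =>
      uniformAvg C.klen (fun ρ => g (a ++ (u ++ (ι ++ ρ))))))) := by
    unfold invertProb
    rw [show (uniformAvg C.m fun x => C.A.pr id (boolPair (unaryEncodeNat C.m) (C.P.F x)) {z | C.P.F z = C.P.F x}) =
        uniformAvg C.m (fun v => 1 - g v) from uniformAvg_congr fun v _ => by simp [hg]]
    rw [uniformAvg_sub_distrib', uniformAvg_const, sub_sub_cancel, hm, uniformAvg_split']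
    refine uniformAvg_congr fun a _ => ?_
    rw [uniformAvg_split']
    refine uniformAvg_congr fun u _ => ?_
    rw [uniformAvg_split']
  -- the slice term `a = sp`, the level term `ι = ι_i`
  have hsp := h.length_sp
  have hι := h.length_ιb hi
  have hstep1 := single_le_uniformAvg' (k := 2 * C.t)
    (fun a => uniformAvg C.rl (fun u => uniformAvg C.il (fun ι => uniformAvg C.klen (fun ρ => g (a ++ (u ++ (ι ++ ρ)))))))
    (fun a _ => uniformAvg_nonneg fun _ => uniformAvg_nonneg fun _ => uniformAvg_nonneg fun _ => hg0 _) hsp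
  have hstep2 : ∀ u : List Bool, uniformAvg C.klen (fun ρ => g (C.sp ++ (u ++ (C.ιb i ++ ρ)))) / 2 ^ C.il ≤
      uniformAvg C.il (fun ι => uniformAvg C.klen (fun ρ => g (C.sp ++ (u ++ (ι ++ ρ))))) := fun u =>
    single_le_uniformAvg' (k := C.il) (fun ι => uniformAvg C.klen (fun ρ => g (C.sp ++ (u ++ (ι ++ ρ)))))
      (fun ι _ => uniformAvg_nonneg fun _ => hg0 _) hι
  have hnat : ∀ u : List Bool, u.length = C.rl → uniformAvg C.klen (fun ρ => g (C.sp ++ (u ++ (C.ιb i ++ ρ)))) = 1 - C.nat u i := by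
    intro u hu
    unfold nat
    rw [← sub_sub_cancel 1 (uniformAvg C.klen _), ← uniformAvg_const C.klen (1 : ℝ), ← uniformAvg_sub_distrib', uniformAvg_const]
    congr 1
    refine uniformAvg_congr fun ρ hρ => ?_
    simp only [hg, sub_sub_cancel]
    rw [show C.sp ++ (u ++ (C.ιb i ++ ρ)) = C.xu u ++ C.ιb i ++ ρ by simp [xu, List.append_assoc]]
    exact C.pr_eq_nat_integrand h hu hρ hi
  have hmid : C.sliceFail i / 2 ^ C.il ≤ uniformAvg C.rl (fun u => uniformAvg C.il (fun ι =>
      uniformAvg C.klen (fun ρ => g (C.sp ++ (u ++ (ι ++ ρ)))))) := by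
    unfold sliceFail
    rw [div_eq_mul_inv, ← uniformAvg_mul_const]
    refine uniformAvg_mono fun u hu => ?_
    rw [← hnat u hu, ← div_eq_mul_inv]
    exact hstep2 u
  have hpos1 : (0 : ℝ) < 2 ^ (2 * C.t) := by positivity
  have hpos2 : (0 : ℝ) < 2 ^ C.il := by positivity
  rw [hinv]
  rw [div_le_iff₀ hpos2] at hmid
  rw [div_le_iff₀ hpos1] at hstep1
  nlinarith [mul_le_mul_of_nonneg_right hstep1 hpos2.le]

end Samples

/-! ### The coins read by the scan -/

section Used

/-- The number of coins the scan reads: `|levels| · blk + 1`. [folklore] -/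
def used (C : Ctx) : ℕ := C.levels.length * C.blk C.κ + 1

end Used

end Ctx

/-! ### The distinguisher as a randomized algorithm with an advice-carrying coin budget -/

/-- An inverter together with a polynomial bounding its coin budget (`IsPPT` gives one). [folklore] -/
structure Adv where
  /-- the inverter -/
  A : RandAlg (List Bool) (List Bool)
  /-- a bound on its coins -/
  qA : Polynomial ℕ

namespace Params

variable (P : Params)

/-- The context attacked with the inverter `Ad.A` at the input length `m`. [folklore] -/
def ctx (Ad : Adv) (m : ℕ) : Ctx := ⟨P, Ad.A, m⟩

/-- The data of the context. [folklore] -/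
@[simp] theorem ctx_P (Ad : Adv) (m : ℕ) : (P.ctx Ad m).P = P := rfl
/-- The inverter of the context. [folklore] -/
@[simp] theorem ctx_A (Ad : Adv) (m : ℕ) : (P.ctx Ad m).A = Ad.A := rfl
/-- The length of the context. [folklore] -/
@[simp] theorem ctx_m (Ad : Adv) (m : ℕ) : (P.ctx Ad m).m = m := rfl

/-- `sl` as a polynomial: `X + R0`. [folklore] -/
def slPoly : Polynomial ℕ := X + R0

/-- **A polynomial bound on the attacked length in terms of the ensemble index**: `m ≤ Mpoly(n)`
(`m < sl (N+1)`, `N ≤ 2L + 2`, `L < Q(n+1)`). [folklore] -/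
def Mpoly : Polynomial ℕ := slPoly.comp (C 2 * P.Qpoly.comp (X + 1) + C 3)

/-- A polynomial bound on the coins read by the scan in terms of `m`. [folklore] -/
def Upoly (Ad : Adv) : Polynomial ℕ :=
  (X + 1) * (X * C 32 * (C 2 * X + C 2) ^ 2) * (C 3 * X + C 6 + Ad.qA.comp (C 5 * X + C 8)) + C 1

/-- **The modulus of the advice code**, a polynomial in the distinguisher's input length exceeding the four low
digits (`used`, `m`, `ℓ₀`, `ℓ₁`) and the top digit `κ` on the attacked inputs. [folklore] -/
def Bpoly (Ad : Adv) : Polynomial ℕ :=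
  (Upoly Ad).comp P.Mpoly + P.Mpoly + P.pc + Ad.qA.comp (C 5 * P.Mpoly + C 8) + C 2

/-- **The run function of the distinguisher `D`** on `w = ⟨1ⁿ, z⟩` with coins `r`: decode `(m, ℓ₀, ℓ₁, κ)` from
`|r|` in base `B(|w|)` (the lowest digit, the number of coins actually read, is skipped) and run the scan of the
context of `m` on the image `bits ℓ₀ ‖ bits ℓ₁ ‖ enc z`. [cite: Goldreich2001, §3.8 Exercise 11 (guideline)] -/
def dRun (Ad : Adv) (w r : List Bool) : Bool :=
  (P.ctx Ad (r.length / (P.Bpoly Ad).eval w.length % (P.Bpoly Ad).eval w.length)).dOut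
    (r.length / (P.Bpoly Ad).eval w.length / (P.Bpoly Ad).eval w.length % (P.Bpoly Ad).eval w.length)
    (r.length / (P.Bpoly Ad).eval w.length / (P.Bpoly Ad).eval w.length / (P.Bpoly Ad).eval w.length % (P.Bpoly Ad).eval w.length)
    (r.length / (P.Bpoly Ad).eval w.length / (P.Bpoly Ad).eval w.length / (P.Bpoly Ad).eval w.length / (P.Bpoly Ad).eval w.length)
    (boolUnpair w).2 r

/-- **The distinguisher** with a prescribed coin budget. [folklore] -/
def dist (Ad : Adv) (cl : ℕ → ℕ) : RandAlg (List Bool) Bool where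
  run := P.dRun Ad
  coinLen := cl

/-- **The advice code** at index `n` (attacked length `mf n`) and sample length `k`:
`used + B (m + B (ℓ₀ + B (ℓ₁ + B κ)))`, `B = B(2n + 2 + k)`. [folklore] -/
def code (Ad : Adv) (mf : ℕ → ℕ) (n k : ℕ) : ℕ :=
  (P.ctx Ad (mf n)).used + (P.Bpoly Ad).eval (2 * n + 2 + k) *
    (mf n + (P.Bpoly Ad).eval (2 * n + 2 + k) * (P.ell false (P.ctx Ad (mf n)).n + (P.Bpoly Ad).eval (2 * n + 2 + k) *
      (P.ell true (P.ctx Ad (mf n)).n + (P.Bpoly Ad).eval (2 * n + 2 + k) * (P.ctx Ad (mf n)).κ)))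

/-- **The coin budget of `D`**: on an input length `2n + 2 + k` with `n ∈ T`, `k ≤ Lz n`, the code of `(n, k)` (well
defined on a sparse `T`, `cl_eq`); zero elsewhere. [folklore] -/
def cl (Ad : Adv) (T : Set ℕ) (Lz mf : ℕ → ℕ) (len : ℕ) : ℕ :=
  if h : ∃ p : ℕ × ℕ, p.1 ∈ T ∧ p.2 ≤ Lz p.1 ∧ len = 2 * p.1 + 2 + p.2 then P.code Ad mf h.choose.1 h.choose.2 else 0

variable {P}

/-- On a sparse set of parameters (`n + Lz n < n'` for `n < n'` in `T`) the input length `2n + 2 + k`, `k ≤ Lz n`,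
determines `(n, k)`, so the budget is the code of `(n, k)` (copy of `CommitmentOneWay.Params.cl_eq`). [folklore] -/
theorem cl_eq {Ad : Adv} {T : Set ℕ} {Lz mf : ℕ → ℕ} (hsep : ∀ n ∈ T, ∀ n' ∈ T, n < n' → n + Lz n < n')
    {n k : ℕ} (hn : n ∈ T) (hk : k ≤ Lz n) : P.cl Ad T Lz mf (2 * n + 2 + k) = P.code Ad mf n k := by
  have hex : ∃ p : ℕ × ℕ, p.1 ∈ T ∧ p.2 ≤ Lz p.1 ∧ 2 * n + 2 + k = 2 * p.1 + 2 + p.2 := ⟨(n, k), hn, hk, rfl⟩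
  unfold cl
  rw [dif_pos hex]
  obtain ⟨h1, h2, h3⟩ := hex.choose_spec
  have h4 : hex.choose.1 = n := by
    rcases lt_trichotomy n hex.choose.1 with hlt | heq | hgt
    · have := hsep n hn _ h1 hlt; omega
    · exact heq.symm
    · have := hsep _ h1 n hn hgt; omega
  have h5 : hex.choose.2 = k := by omega
  rw [h4, h5]

/-- **Decoding the advice**: with the four low digits below `B`,
`c = u + B(m + B(l₀ + B(l₁ + B κ)))` gives back `m, l₀, l₁, κ`. [folklore] -/
theorem decode {B u m l0 l1 κ : ℕ} (hu : u < B) (hm : m < B) (h0 : l0 < B) (h1 : l1 < B) :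
    (u + B * (m + B * (l0 + B * (l1 + B * κ)))) / B % B = m ∧
      (u + B * (m + B * (l0 + B * (l1 + B * κ)))) / B / B % B = l0 ∧
      (u + B * (m + B * (l0 + B * (l1 + B * κ)))) / B / B / B % B = l1 ∧
      (u + B * (m + B * (l0 + B * (l1 + B * κ)))) / B / B / B / B = κ := by
  have hB : 0 < B := by omega
  have e1 : (u + B * (m + B * (l0 + B * (l1 + B * κ)))) / B = m + B * (l0 + B * (l1 + B * κ)) := by
    rw [Nat.add_mul_div_left _ _ hB, Nat.div_eq_of_lt hu, zero_add]
  have e2 : (m + B * (l0 + B * (l1 + B * κ))) / B = l0 + B * (l1 + B * κ) := by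
    rw [Nat.add_mul_div_left _ _ hB, Nat.div_eq_of_lt hm, zero_add]
  have e3 : (l0 + B * (l1 + B * κ)) / B = l1 + B * κ := by
    rw [Nat.add_mul_div_left _ _ hB, Nat.div_eq_of_lt h0, zero_add]
  have e4 : (l1 + B * κ) / B = κ := by
    rw [Nat.add_mul_div_left _ _ hB, Nat.div_eq_of_lt h1, zero_add]
  rw [e1, e2, e3, e4]
  exact ⟨by rw [Nat.add_mul_mod_self_left, Nat.mod_eq_of_lt hm], by rw [Nat.add_mul_mod_self_left, Nat.mod_eq_of_lt h0],
    by rw [Nat.add_mul_mod_self_left, Nat.mod_eq_of_lt h1], rfl⟩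

/-! ### The size of the parameters -/

/-- `sl N = slPoly(N)`. [folklore] -/
@[simp] theorem eval_slPoly (N : ℕ) : slPoly.eval N = sl N := by simp [slPoly, sl]

/-- **The attacked length is polynomial in the index**: `m ≤ Mpoly(n)` for a well-formed context. [folklore] -/
theorem m_le_Mpoly (C : Ctx) : C.m ≤ C.P.Mpoly.eval C.n := by
  have h1 : C.m < sl (C.N + 1) := lt_sl_lvl_succ C.m
  have h2 : C.N ≤ 2 * C.L + 2 := le_two_mul_nLen C.N
  have h3 : C.L < C.P.Q (C.n + 1) := C.P.lt_Q_nPar_succ C.L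
  have h4 : sl (C.N + 1) ≤ sl (2 * C.P.Q (C.n + 1) + 3) := sl_strictMono.monotone (by omega)
  have : C.P.Mpoly.eval C.n = sl (2 * C.P.Q (C.n + 1) + 3) := by simp [Mpoly, Params.Q]
  omega

/-- `2^{eLen N + 1} ≤ 32 (2N + 2)²`. [folklore] -/
theorem two_pow_eLen_succ_le (N : ℕ) : 2 ^ (eLen N + 1) ≤ 32 * (2 * N + 2) ^ 2 := by
  have hb := two_pow_bLen_le N
  calc 2 ^ (eLen N + 1) = 32 * (2 ^ bLen N) ^ 2 := by rw [eLen]; ring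
    _ ≤ 32 * (2 * N + 2) ^ 2 := by gcongr

/-- **The scan reads polynomially many coins**: `used ≤ Upoly(m)` (for `coinLen ≤ qA`). [folklore] -/
theorem used_le_Upoly {C : Ctx} (h : C.WF) {qA : Polynomial ℕ} (hqA : ∀ l, C.A.coinLen l ≤ qA.eval l) :
    C.used ≤ (Upoly ⟨C.A, qA⟩).eval C.m := by
  have hN := h.N_le
  have hL : C.L ≤ C.N := nLen_le _
  have hT : C.T ≤ C.m * (32 * (2 * C.m + 2) ^ 2) := by
    unfold Ctx.T
    calc C.N * 2 ^ (eLen C.N + 1) ≤ C.N * (32 * (2 * C.N + 2) ^ 2) := Nat.mul_le_mul_left _ (two_pow_eLen_succ_le _)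
      _ ≤ C.m * (32 * (2 * C.m + 2) ^ 2) := by gcongr
  have hh : hLen C.N ≤ 2 * C.m + 6 := (hLen_le _).trans (by omega)
  have hq : C.qlen ≤ 5 * C.m + 8 := by unfold Ctx.qlen; omega
  have hκ : C.κ ≤ qA.eval (5 * C.m + 8) := (hqA _).trans (natPoly_eval_mono _ hq)
  have hk : C.klen ≤ C.m := Nat.sub_le _ _
  have hblk : C.blk C.κ ≤ 3 * C.m + 6 + qA.eval (5 * C.m + 8) := by unfold Ctx.blk; omega
  have hlev : C.levels.length = (C.L + 1) * C.T := C.length_levelsGE 0 (C.L + 1)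
  unfold Ctx.used
  rw [hlev]
  have e : (Upoly ⟨C.A, qA⟩).eval C.m = (C.m + 1) * (C.m * 32 * (2 * C.m + 2) ^ 2) * (3 * C.m + 6 + qA.eval (5 * C.m + 8)) + 1 := by
    simp [Upoly]
  rw [e]
  have : (C.L + 1) * C.T * C.blk C.κ ≤ (C.m + 1) * (C.m * 32 * (2 * C.m + 2) ^ 2) * (3 * C.m + 6 + qA.eval (5 * C.m + 8)) := by
    have h1 : C.L + 1 ≤ C.m + 1 := by omega
    have h2 : C.T ≤ C.m * 32 * (2 * C.m + 2) ^ 2 := by rw [mul_assoc]; exact hT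
    exact Nat.mul_le_mul (Nat.mul_le_mul h1 h2) hblk
  omega

/-- Value of the modulus. [folklore] -/
theorem eval_Bpoly (Ad : Adv) (x : ℕ) : (P.Bpoly Ad).eval x =
    (Upoly Ad).eval (P.Mpoly.eval x) + P.Mpoly.eval x + P.pc.eval x + Ad.qA.eval (5 * P.Mpoly.eval x + 8) + 2 := by
  simp [Bpoly]

/-- **The digits of the advice are below the modulus** on the attacked inputs (`len ≥ n`). [folklore] -/
theorem digits_lt {Ad : Adv} (hqA : ∀ l, Ad.A.coinLen l ≤ Ad.qA.eval l) {m : ℕ} (h : (P.ctx Ad m).WF) {len : ℕ}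
    (hlen : (P.ctx Ad m).n ≤ len) :
    (P.ctx Ad m).used < (P.Bpoly Ad).eval len ∧ m < (P.Bpoly Ad).eval len ∧
      P.ell false (P.ctx Ad m).n < (P.Bpoly Ad).eval len ∧ P.ell true (P.ctx Ad m).n < (P.Bpoly Ad).eval len ∧
      (P.ctx Ad m).κ < (P.Bpoly Ad).eval len := by
  set C := P.ctx Ad m with hC
  have hm : m ≤ P.Mpoly.eval len := (m_le_Mpoly C).trans (natPoly_eval_mono _ hlen)
  have hu : C.used ≤ (Upoly Ad).eval (P.Mpoly.eval len) := (used_le_Upoly h hqA).trans (natPoly_eval_mono _ hm)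
  have hl : ∀ σ, P.ell σ C.n ≤ P.pc.eval len := fun σ => (h.coin σ).trans (natPoly_eval_mono _ hlen)
  have hq : C.qlen ≤ 5 * P.Mpoly.eval len + 8 := by
    have := hLen_le C.N; have := h.N_le; unfold Ctx.qlen; simp only [hC, ctx_m] at *; omega
  have hκ : C.κ ≤ Ad.qA.eval (5 * P.Mpoly.eval len + 8) := (hqA _).trans (natPoly_eval_mono _ hq)
  rw [eval_Bpoly]
  have h0 := hl false; have h1 := hl true
  refine ⟨?_, ?_, ?_, ?_, ?_⟩ <;> omega

/-- **The budget is polynomially bounded** (`≤ 5 B⁶`), provided the contexts attacked along `T` are well formed with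
the right index. [folklore] -/
theorem cl_le {Ad : Adv} (hqA : ∀ l, Ad.A.coinLen l ≤ Ad.qA.eval l) {T : Set ℕ} {Lz mf : ℕ → ℕ}
    (hT : ∀ n ∈ T, (P.ctx Ad (mf n)).WF ∧ (P.ctx Ad (mf n)).n = n) (len : ℕ) :
    P.cl Ad T Lz mf len ≤ (C 5 * P.Bpoly Ad ^ 6).eval len := by
  unfold cl
  split_ifs with hex
  · obtain ⟨h1, -, h3⟩ := hex.choose_spec
    set n := hex.choose.1
    set k := hex.choose.2
    obtain ⟨hwf, hn⟩ := hT n h1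
    obtain ⟨hu, hm, hl0, hl1, hκ⟩ := digits_lt hqA hwf (len := 2 * n + 2 + k) (by rw [hn]; omega)
    rw [h3, eval_mul, eval_C, eval_pow, code]
    set B := (P.Bpoly Ad).eval (2 * n + 2 + k)
    have hB : 1 ≤ B := by omega
    calc (P.ctx Ad (mf n)).used + B * (mf n + B * (P.ell false (P.ctx Ad (mf n)).n + B * (P.ell true (P.ctx Ad (mf n)).n +
          B * (P.ctx Ad (mf n)).κ))) ≤ B + B * (B + B * (B + B * (B + B * B))) := by
          refine Nat.add_le_add hu.le (Nat.mul_le_mul_left _ (Nat.add_le_add hm.le (Nat.mul_le_mul_left _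
            (Nat.add_le_add hl0.le (Nat.mul_le_mul_left _ (Nat.add_le_add hl1.le (Nat.mul_le_mul_left _ hκ.le)))))))
      _ ≤ 5 * B ^ 6 := by
          have h2 : B ≤ B ^ 6 := Nat.le_self_pow (by norm_num) B
          have h3 : B * B ≤ B ^ 6 := by
            calc B * B = B ^ 2 := (sq B).symm
              _ ≤ B ^ 6 := Nat.pow_le_pow_right hB (by norm_num)
          have h4 : B * B * B ≤ B ^ 6 := by
            calc B * B * B = B ^ 3 := by ring
              _ ≤ B ^ 6 := Nat.pow_le_pow_right hB (by norm_num)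
          have h5 : B * B * B * B ≤ B ^ 6 := by
            calc B * B * B * B = B ^ 4 := by ring
              _ ≤ B ^ 6 := Nat.pow_le_pow_right hB (by norm_num)
          have h6 : B * B * B * B * B * B = B ^ 6 := by ring
          nlinarith
  · exact Nat.zero_le _

/-! ### What `D` computes on the sparse set -/

/-- `uniformProb` as a uniform average of an indicator (private copy). [folklore] -/
private theorem uniformProb_eq_uniformAvg'' (m : ℕ) (E : Set (List Bool)) [DecidablePred (· ∈ E)] :
    uniformProb m E = uniformAvg m (fun s => if s ∈ E then 1 else 0) := by
  classical
  unfold uniformProb uniformAvg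
  rw [Finset.sum_boole]
  congr

/-- **`D` simulates the scan exactly on the sparse set.** For `n ∈ T`, `|z| ≤ Lz n`, with `m = mf n` attacked
and the context of `m` well formed with index `n`:
`Pr[D(1ⁿ, z) = 1] = acc (yZ z)`, the first-success value of the scan on the image of `z`. [folklore] -/
theorem pr_dist_eq {Ad : Adv} {T : Set ℕ} {Lz mf : ℕ → ℕ} (hsep : ∀ n ∈ T, ∀ n' ∈ T, n < n' → n + Lz n < n')
    (hqA : ∀ l, Ad.A.coinLen l ≤ Ad.qA.eval l) {n : ℕ} (hn : n ∈ T) (h : (P.ctx Ad (mf n)).WF) (hCn : (P.ctx Ad (mf n)).n = n)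
    {z : List Bool} (hz : z.length ≤ Lz n) :
    (P.dist Ad (P.cl Ad T Lz mf)).pr id (boolPair (unaryEncodeNat n) z) {true} = (P.ctx Ad (mf n)).acc ((P.ctx Ad (mf n)).yZ z) := by
  set C := P.ctx Ad (mf n) with hC
  have hw : (id (boolPair (unaryEncodeNat n) z)).length = 2 * n + 2 + z.length := by
    simp [Complexity.unaryEncodeNat_eq_replicate]
  rw [RandAlg.pr_eq_uniformProb, hw]
  simp only [dist]
  rw [cl_eq hsep hn hz, code]
  set B := (P.Bpoly Ad).eval (2 * n + 2 + z.length) with hB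
  obtain ⟨hu, hm, hl0, hl1, -⟩ := digits_lt hqA h (len := 2 * n + 2 + z.length) (by rw [hCn]; omega)
  obtain ⟨d1, d2, d3, d4⟩ := decode (κ := C.κ) hu hm hl0 hl1
  -- every coin string of the prescribed length runs the scan
  have hrun : ∀ r : List Bool, r.length = C.used + B * (mf n + B * (P.ell false C.n + B * (P.ell true C.n + B * C.κ))) →
      (P.dRun Ad (boolPair (unaryEncodeNat n) z) r = true ↔ C.scan C.κ (C.yZ z) C.levels r = true) := by
    intro r hr
    have hwl : (boolPair (unaryEncodeNat n) z).length = 2 * n + 2 + z.length := by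
      simp [Complexity.unaryEncodeNat_eq_replicate]
    unfold dRun
    rw [hwl, ← hB, hr, d1, d2, d3, d4, boolUnpair_boolPair]
    show C.scan C.κ (C.yOf (C.P.ell false C.n) (C.P.ell true C.n) z) C.levels r = true ↔ C.scan C.κ (C.yZ z) C.levels r = true
    rw [C.yOf_ell]
  rw [uniformProb_congr (E' := {r | r.take C.used ∈ {r' | C.scan C.κ (C.yZ z) C.levels r' = true}}) (fun r hr => by
    rw [Set.mem_setOf_eq, Set.mem_singleton_iff, hrun r hr, Set.mem_setOf_eq, Set.mem_setOf_eq, Ctx.used, C.scan_take])]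
  rw [uniformProb_take_of_le (Nat.le_add_right _ _), uniformProb_eq_uniformAvg'', Ctx.acc]
  have := C.uniformAvg_scan_eq_run (C.yZ z) C.levels 0
  rw [add_zero] at this
  rw [← this, Ctx.used]
  exact uniformAvg_congr fun r _ => if_congr Iff.rfl rfl rfl

end Params

end FarApartOWF

end

end Literature.Computability.Cryptography

/-!
## Part VI — the asymptotic reduction

Part VI of the discharge of `Goldreich2001_owfExist_of_indistinguishable_farApart` (Goldreich 2001, §3.8
Exercise 11). Here the single-length estimates of the previous files are turned into the statement
**`F = g f̃` is weakly one-way** (`Params.isWeaklyOneWay_F`), with the efficiency of the distinguishers as a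
hypothesis (discharged in Part VII below, `DProg.dist_isPPT`), exactly in the format
of `CommitmentOneWay.Params.isWeaklyOneWay_F`:

if `X n = S₀(1ⁿ)`, `Y n = S₁(1ⁿ)` are computationally indistinguishable and statistically far apart
(`Δ(X n, Y n) > 1/pd(n)` eventually) then every PPT inverter of `F` fails with probability `≥ 1/qW(m)` for all
large `m`. Otherwise some PPT `A` inverts too well at infinitely many lengths `m`; each such `m` gives an index
`n(m)` at which, by `sq_tvDist_sub_le_abs`, `sum_FailSum_eq`, `sliceFail_le` and the choice of `qW`, the
distinguisher `D` (advice `(m, ℓ₀, ℓ₁, κ)` in its coin budget, along a sparse subsequence of the good indices —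
`Yao.seqN`) has advantage `≥ 1/(2 pd(n)²)`, contradicting the negligibility of its advantage multiplied by the
polynomial `2 pd²` (`SuperpolynomialDecay.polynomial_mul`).

## References

* O. Goldreich, *Foundations of Cryptography I*, CUP 2001, §3.8 Exercise 11 (guideline), Def. 2.2.2 (weakly
  one-way), Def. 3.2.2 (computational indistinguishability).
* O. Goldreich, *A Primer on Pseudorandom Generators*, AMS 2010, Exercise 2.8 ("statistically far apart").
-/

namespace Literature.Computability.Cryptography

open Filter Finset Polynomial Asymptotics _root_.Computability Complexity AffineStr HILL

noncomputable section

namespace FarApartOWF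

open scoped Classical

namespace Params

variable (P : Params)

/-- **The weak one-wayness polynomial** `qW = 32 (X+1) (2 pc + 2)² (2X + 2) pd² + 1`. [folklore] -/
def qW : Polynomial ℕ := C 32 * (X + 1) * (C 2 * P.pc + C 2) ^ 2 * (C 2 * X + C 2) * P.pd ^ 2 + C 1

/-- Value of `qW`. [folklore] -/
theorem eval_qW (m : ℕ) : P.qW.eval m = 32 * (m + 1) * (2 * P.pc.eval m + 2) ^ 2 * (2 * m + 2) * P.pd.eval m ^ 2 + 1 := by
  simp [qW]

variable {P}

/-! ### Asymptotics of the level parameters -/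

/-- `nLen N → ∞`. [folklore] -/
theorem tendsto_nLen : Tendsto nLen atTop atTop := by
  refine tendsto_atTop_atTop.2 fun L => ⟨2 * L + 2, fun N hN => ?_⟩
  have := le_two_mul_nLen N
  omega

/-- The ensemble index of the context of `m` tends to infinity with `m`. [folklore] -/
theorem tendsto_ctx_n (Ad : Adv) : Tendsto (fun m => (P.ctx Ad m).n) atTop atTop :=
  P.tendsto_nPar.comp (tendsto_nLen.comp tendsto_lvl)

/-- **Contexts of large lengths are well formed** (and their level is at least `12`). [folklore] -/
theorem eventually_WF (Ad : Adv) (hc : ∀ σ n, P.ell σ n ≤ P.pc.eval n) :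
    ∀ᶠ m in atTop, (P.ctx Ad m).WF ∧ 12 ≤ (P.ctx Ad m).N := by
  have h1 : ∀ᶠ m : ℕ in atTop, 6 ≤ m := eventually_ge_atTop 6
  have h2 : ∀ᶠ m : ℕ in atTop, 12 ≤ lvl m := tendsto_lvl.eventually (eventually_ge_atTop 12)
  have h3 : ∀ᶠ m : ℕ in atTop, P.Q 0 ≤ nLen (lvl m) := (tendsto_nLen.comp tendsto_lvl).eventually (eventually_ge_atTop _)
  filter_upwards [h1, h2, h3] with m hm hN hL
  exact ⟨⟨hm, by show 1 ≤ lvl m; omega, P.Q_nPar_le hL, fun σ => hc σ _⟩, hN⟩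

/-! ### The error terms at a good length -/

/-- **The choice of `qW` controls the natural failure**: at a well-formed length where the inverter succeeds with
probability `> 1 − 1/qW(m)`, `8 (L+1) 2^{2t} 2^{il} (1 − invertProb) < 1/(4 pd(n)²)`. [folklore] -/
theorem err_inv_lt {C : Ctx} (h : C.WF) (hpd : ∀ n, 0 < C.P.pd.eval n)
    (hinv : 1 - 1 / ((C.P.qW.eval C.m : ℕ) : ℝ) < invertProb C.P.F C.A C.m) :
    8 * (C.L + 1) * 2 ^ (2 * C.t) * 2 ^ C.il * (1 - invertProb C.P.F C.A C.m) < 1 / (4 * ((C.P.pd.eval C.n : ℕ) : ℝ) ^ 2) := by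
  have hnm : C.n ≤ C.m := (C.P.nPar_le _).trans ((nLen_le _).trans h.N_le)
  have hL : C.L ≤ C.m := (nLen_le _).trans h.N_le
  have ht : (2 : ℝ) ^ (2 * C.t) ≤ (2 * C.P.pc.eval C.m + 2) ^ 2 := by
    have h1 : 2 ^ C.t ≤ 2 * C.P.pc.eval C.n + 2 := C.P.two_pow_tLen_le C.n
    have h2 : C.P.pc.eval C.n ≤ C.P.pc.eval C.m := natPoly_eval_mono _ hnm
    have : (2 : ℝ) ^ C.t ≤ 2 * C.P.pc.eval C.m + 2 := by exact_mod_cast h1.trans (by omega)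
    calc (2 : ℝ) ^ (2 * C.t) = (2 ^ C.t) ^ 2 := by rw [pow_mul']
      _ ≤ _ := by gcongr
  have hil : (2 : ℝ) ^ C.il ≤ 2 * C.m + 2 := by
    rw [h.il_eq]
    exact_mod_cast (two_pow_bLen_le C.N).trans (by have := h.N_le; omega)
  have hpdm : ((C.P.pd.eval C.n : ℕ) : ℝ) ≤ C.P.pd.eval C.m := by exact_mod_cast natPoly_eval_mono _ hnm
  have hpd0 : (0 : ℝ) < C.P.pd.eval C.n := by exact_mod_cast hpd C.n
  have hq : ((C.P.qW.eval C.m : ℕ) : ℝ) = 32 * (C.m + 1) * (2 * C.P.pc.eval C.m + 2) ^ 2 * (2 * C.m + 2) * C.P.pd.eval C.m ^ 2 + 1 := by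
    rw [eval_qW]; push_cast; ring
  have hqpos : (0 : ℝ) < ((C.P.qW.eval C.m : ℕ) : ℝ) := by rw [hq]; positivity
  have hfail : 1 - invertProb C.P.F C.A C.m < 1 / ((C.P.qW.eval C.m : ℕ) : ℝ) := by linarith
  have hfail0 : 0 ≤ 1 - invertProb C.P.F C.A C.m := sub_nonneg.2 (invertProb_le_one _ _ _)
  -- the product of the bounds
  have hK : (8 : ℝ) * (C.L + 1) * 2 ^ (2 * C.t) * 2 ^ C.il * (4 * ((C.P.pd.eval C.n : ℕ) : ℝ) ^ 2) ≤ C.P.qW.eval C.m := by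
    rw [hq]
    have hL' : (C.L : ℝ) + 1 ≤ C.m + 1 := by exact_mod_cast Nat.succ_le_succ hL
    calc (8 : ℝ) * (C.L + 1) * 2 ^ (2 * C.t) * 2 ^ C.il * (4 * ((C.P.pd.eval C.n : ℕ) : ℝ) ^ 2)
        = 32 * ((C.L + 1) * 2 ^ (2 * C.t) * 2 ^ C.il * ((C.P.pd.eval C.n : ℕ) : ℝ) ^ 2) := by ring
      _ ≤ 32 * ((C.m + 1) * (2 * C.P.pc.eval C.m + 2) ^ 2 * (2 * C.m + 2) * ((C.P.pd.eval C.m : ℕ) : ℝ) ^ 2) := by gcongr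
      _ ≤ _ := by linarith
  have hKpos : (0 : ℝ) < 8 * (C.L + 1) * 2 ^ (2 * C.t) * 2 ^ C.il := by positivity
  rw [lt_div_iff₀ (mul_pos (by norm_num) (pow_pos hpd0 2))]
  calc 8 * (C.L + 1) * 2 ^ (2 * C.t) * 2 ^ C.il * (1 - invertProb C.P.F C.A C.m) * (4 * ((C.P.pd.eval C.n : ℕ) : ℝ) ^ 2)
      = (8 * (C.L + 1) * 2 ^ (2 * C.t) * 2 ^ C.il * (4 * ((C.P.pd.eval C.n : ℕ) : ℝ) ^ 2)) * (1 - invertProb C.P.F C.A C.m) := by ring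
    _ ≤ ((C.P.qW.eval C.m : ℕ) : ℝ) * (1 - invertProb C.P.F C.A C.m) := mul_le_mul_of_nonneg_right hK hfail0
    _ < ((C.P.qW.eval C.m : ℕ) : ℝ) * (1 / ((C.P.qW.eval C.m : ℕ) : ℝ)) := mul_lt_mul_of_pos_left hfail hqpos
    _ = 1 := by field_simp

/-- **The scan's own error is small**: `2 (2/2^g + e^{−N}) ≤ 1/(4 pd(n)²)` at a well-formed length with `N ≥ 12`
(`2^g = 8 · 4^{bLen N} ≥ 8 N²`, `e^N ≥ N³/6 ≥ 2 N²`, `N ≥ 3 pd(n)`). [folklore] -/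
theorem err_scan_le {C : Ctx} (h : C.WF) (hN : 12 ≤ C.N) (hpd : ∀ n, 0 < C.P.pd.eval n) :
    2 * (2 / (2 : ℝ) ^ C.gl + Real.exp (-(C.N : ℝ))) ≤ 1 / (4 * ((C.P.pd.eval C.n : ℕ) : ℝ) ^ 2) := by
  have hpd0 : (0 : ℝ) < C.P.pd.eval C.n := by exact_mod_cast hpd C.n
  have hNpd : 3 * ((C.P.pd.eval C.n : ℕ) : ℝ) ≤ C.N := by
    have := (C.P.three_mul_pd_le_Q C.n).trans (h.served.trans (nLen_le C.N))
    exact_mod_cast this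
  have hNr : (12 : ℝ) ≤ C.N := by exact_mod_cast hN
  -- `2^g ≥ 8 N²`
  have hg : (8 : ℝ) * C.N ^ 2 ≤ 2 ^ C.gl := by
    have h1 : (C.N : ℝ) < 2 ^ bLen C.N := by exact_mod_cast lt_two_pow_bLen C.N
    have h2 : C.gl = 2 * bLen C.N + 3 := by unfold Ctx.gl eLen; omega
    rw [h2, pow_add, mul_comm 2 (bLen C.N), pow_mul]
    have h0 : (0 : ℝ) ≤ C.N := Nat.cast_nonneg _
    have h3 : (C.N : ℝ) ^ 2 ≤ (2 ^ bLen C.N) ^ 2 := pow_le_pow_left₀ h0 h1.le 2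
    nlinarith
  -- `e^N ≥ 2 N²`
  have he : 2 * (C.N : ℝ) ^ 2 ≤ Real.exp C.N := by
    have h3 := Real.pow_div_factorial_le_exp (C.N : ℝ) (Nat.cast_nonneg C.N) 3
    have hf : ((Nat.factorial 3 : ℕ) : ℝ) = 6 := by norm_num [Nat.factorial]
    rw [hf] at h3
    have : 2 * (C.N : ℝ) ^ 2 ≤ (C.N : ℝ) ^ 3 / 6 := by
      rw [le_div_iff₀ (by norm_num)]; nlinarith
    linarith
  have h16 : (0 : ℝ) < 16 * ((C.P.pd.eval C.n : ℕ) : ℝ) ^ 2 := mul_pos (by norm_num) (pow_pos hpd0 2)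
  have hterm1 : 2 / (2 : ℝ) ^ C.gl ≤ 1 / (16 * ((C.P.pd.eval C.n : ℕ) : ℝ) ^ 2) := by
    rw [div_le_div_iff₀ (by positivity) h16]
    nlinarith
  have hterm2 : Real.exp (-(C.N : ℝ)) ≤ 1 / (16 * ((C.P.pd.eval C.n : ℕ) : ℝ) ^ 2) := by
    rw [Real.exp_neg, inv_eq_one_div, div_le_div_iff₀ (Real.exp_pos _) h16]
    nlinarith
  have : 1 / (16 * ((C.P.pd.eval C.n : ℕ) : ℝ) ^ 2) * 4 = 1 / (4 * ((C.P.pd.eval C.n : ℕ) : ℝ) ^ 2) := by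
    field_simp; ring
  linarith

/-! ### The acceptance probabilities of `D` on the two ensembles -/

/-- The acceptance probability of a distinguisher on `S_σ(1ⁿ)` as an average over the sampler's coins. [folklore] -/
theorem toReal_acceptPMF_outputPMF (D : RandAlg (List Bool) Bool) (S : RandAlg ℕ (List Bool)) (n : ℕ) :
    (acceptPMF D n (S.outputPMF unaryEncodeNat n) true).toReal =
      uniformAvg (S.coinLen n) (fun r => D.pr id (boolPair (unaryEncodeNat n) (S.run n r)) {true}) := by
  rw [outputPMF_unary_eq, acceptPMF, PMF.bind_map, bind_uniformBits_apply_toReal]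
  refine uniformAvg_congr fun r _ => ?_
  rw [Function.comp_apply, RandAlg.pr, PMF.toOuterMeasure_apply_singleton]

/-! ### The main theorem: `F` is weakly one-way -/

/-- **Constructible, indistinguishable, far-apart samplers give a weak one-way function** — the reduction, with
the efficiency of the distinguishers as a hypothesis: if the two output ensembles `n ↦ S₀(1ⁿ)`, `n ↦ S₁(1ⁿ)` are
computationally indistinguishable and `Δ(S₀(1ⁿ), S₁(1ⁿ)) > 1/pd(n)` for all large `n`, then every PPT inverter of
`F = g f̃` fails with probability `≥ 1/qW(m)` for all large `m`.
[cite: Goldreich2001, §3.8 Exercise 11 (guideline) with Ch. 2 Exercise 17] -/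
theorem isWeaklyOneWay_F (P : Params) (hc : ∀ σ n, P.ell σ n ≤ P.pc.eval n)
    (ho : ∀ (σ : Bool) (n : ℕ) (r : List Bool), r.length ≤ P.pc.eval n → ((P.S σ).run n r).length ≤ P.po.eval n)
    (hF : PolyTimeComputable id id P.F) (hpd : ∀ n, 0 < P.pd.eval n)
    (hfar : ∀ᶠ n in atTop, 1 / ((P.pd.eval n : ℕ) : ℝ) < (P.S0.outputPMF unaryEncodeNat n).tvDist (P.S1.outputPMF unaryEncodeNat n))
    (hind : IsCompIndistinguishable (fun n => P.S0.outputPMF unaryEncodeNat n) (fun n => P.S1.outputPMF unaryEncodeNat n))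
    (hD : ∀ (Ad : Adv) (cl : ℕ → ℕ), IsPPT Ad.A id → (∃ pc : Polynomial ℕ, ∀ L, cl L ≤ pc.eval L) → IsPPT (P.dist Ad cl) encodeBool) :
    IsWeaklyOneWay P.F := by
  refine ⟨hF, P.qW, fun m => by rw [eval_qW]; omega, fun A hA => ?_⟩
  by_contra hne
  obtain ⟨qA, hqA⟩ := hA.2
  let Ad : Adv := ⟨A, qA⟩
  -- (1) frequently the inverter does too well, at well-formed lengths
  have hfreq : ∃ᶠ m in atTop, 1 - 1 / ((P.qW.eval m : ℕ) : ℝ) < invertProb P.F A m := by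
    rw [not_eventually] at hne
    exact hne.mono fun m hm => not_le.1 hm
  let GoodM : ℕ → Prop := fun m => (P.ctx Ad m).WF ∧ 12 ≤ (P.ctx Ad m).N ∧
    8 * ((P.ctx Ad m).L + 1) * 2 ^ (2 * (P.ctx Ad m).t) * 2 ^ (P.ctx Ad m).il * (1 - invertProb P.F A m) <
      1 / (4 * ((P.pd.eval (P.ctx Ad m).n : ℕ) : ℝ) ^ 2)
  have hgoodM : ∃ᶠ m in atTop, GoodM m := by
    refine (hfreq.and_eventually (eventually_WF Ad hc)).mono fun m hm => ?_
    obtain ⟨hinv, hwf, hN⟩ := hm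
    exact ⟨hwf, hN, err_inv_lt hwf hpd hinv⟩
  -- (2) pass to the indices
  let GoodN : ℕ → Prop := fun n => ∃ m, GoodM m ∧ (P.ctx Ad m).n = n
  have hgoodN : ∃ᶠ n in atTop, GoodN n :=
    (tendsto_ctx_n Ad).frequently (hgoodM.mono fun m hm => ⟨m, hm, rfl⟩)
  let G' : ℕ → Prop := fun n => GoodN n ∧ 1 / ((P.pd.eval n : ℕ) : ℝ) < (P.S0.outputPMF unaryEncodeNat n).tvDist (P.S1.outputPMF unaryEncodeNat n)
  have hG'freq : ∃ᶠ n in atTop, G' n := hgoodN.and_eventually hfar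
  have hG' : ∀ a, ∃ b, a ≤ b ∧ G' b := fun a => by
    obtain ⟨b, hb, h⟩ := frequently_atTop.1 hG'freq a
    exact ⟨b, hb, h⟩
  -- (3) the advice: attacked length per index, the sparse set
  let mf : ℕ → ℕ := fun n => if h : GoodN n then h.choose else 0
  have hmf : ∀ n, GoodN n → GoodM (mf n) ∧ (P.ctx Ad (mf n)).n = n := fun n hn => by
    simp only [mf, dif_pos hn]; exact hn.choose_spec
  let Lz : ℕ → ℕ := fun n => P.po.eval n
  let w : ℕ → ℕ := fun n => n + Lz n
  have hw : ∀ n, n ≤ w n := fun n => Nat.le_add_right _ _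
  let φ : ℕ → ℕ := Yao.seqN G' w
  have hφ : StrictMono φ := Yao.seqN_strictMono hG' hw
  let T : Set ℕ := Set.range φ
  have hsep : ∀ n ∈ T, ∀ n' ∈ T, n < n' → n + Lz n < n' := by
    rintro _ ⟨i, rfl⟩ _ ⟨j, rfl⟩ hlt
    have hij : i < j := hφ.lt_iff_lt.1 hlt
    calc φ i + Lz (φ i) < φ (i + 1) := Yao.w_seqN_lt (w := w) hG' i
      _ ≤ φ j := hφ.monotone hij
  have hT : ∀ n ∈ T, (P.ctx Ad (mf n)).WF ∧ (P.ctx Ad (mf n)).n = n := by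
    rintro _ ⟨j, rfl⟩
    obtain ⟨hgood, -⟩ := Yao.seqN_good hG' j
    obtain ⟨hM, hn⟩ := hmf _ hgood
    exact ⟨hM.1, hn⟩
  -- (4) the distinguisher and the negligibility of its advantage
  let D := P.dist Ad (P.cl Ad T Lz mf)
  have hDppt : IsPPT D encodeBool := hD Ad _ hA ⟨C 5 * P.Bpoly Ad ^ 6, fun L => cl_le hqA hT L⟩
  have hadv := hind D hDppt
  have hdec := (hadv.polynomial_mul ((C 2 * P.pd ^ 2).map (Nat.castRingHom ℝ))) 0
  simp only [pow_zero, one_mul, Polynomial.eval_natCast_map] at hdec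
  have hsmall : ∀ᶠ n : ℕ in atTop, (((C 2 * P.pd ^ 2).eval n : ℕ) : ℝ) *
      distAdvantage D (fun n => P.S0.outputPMF unaryEncodeNat n) (fun n => P.S1.outputPMF unaryEncodeNat n) n < 1 :=
    hdec.eventually (gt_mem_nhds one_pos)
  have hTfreq : ∃ᶠ n in atTop, n ∈ T := frequently_atTop.2 fun a => ⟨φ a, hφ.id_le a, a, rfl⟩
  obtain ⟨_, hsm, ⟨j, rfl⟩⟩ := (hsmall.and_frequently hTfreq).exists
  -- (5) the advantage at the good index `n = φ j`
  set n := φ j with hndef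
  obtain ⟨hgood, hfarN⟩ := Yao.seqN_good hG' j
  obtain ⟨⟨hWF, hN12, herr⟩, hCn⟩ := hmf n hgood
  set Cx := P.ctx Ad (mf n) with hCx
  have ho' : ∀ (σ : Bool) (r : List Bool), r.length ≤ Cx.P.pc.eval Cx.n → ((Cx.P.S σ).run Cx.n r).length ≤ Cx.P.po.eval Cx.n :=
    fun σ r hr => ho σ _ r hr
  -- what `D` accepts
  have hφD : ∀ u : List.Vector Bool Cx.rl, D.pr id (boolPair (unaryEncodeNat n) (Cx.zR u)) {true} = Cx.acc (Cx.yZ (Cx.zR u)) :=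
    fun u => pr_dist_eq hsep hqA ⟨j, rfl⟩ hWF hCn ((Cx.length_zR_le ho' u).trans (by rw [hCn]; exact le_rfl))
  have hmain := Cx.sq_tvDist_sub_le_abs hWF ho' (fun z => D.pr id (boolPair (unaryEncodeNat n) z) {true}) hφD
  -- identify the two averages with the acceptance probabilities
  have hX : uniformAvg (Cx.P.ell false Cx.n) (fun r => D.pr id (boolPair (unaryEncodeNat n) (Cx.P.S0.run Cx.n r)) {true}) =
      (acceptPMF D n (P.S0.outputPMF unaryEncodeNat n) true).toReal := by
    rw [toReal_acceptPMF_outputPMF]; simp only [hCn]; rfl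
  have hY : uniformAvg (Cx.P.ell true Cx.n) (fun r => D.pr id (boolPair (unaryEncodeNat n) (Cx.P.S1.run Cx.n r)) {true}) =
      (acceptPMF D n (P.S1.outputPMF unaryEncodeNat n) true).toReal := by
    rw [toReal_acceptPMF_outputPMF]; simp only [hCn]; rfl
  rw [hX, hY] at hmain
  have hadv_eq : |(acceptPMF D n (P.S1.outputPMF unaryEncodeNat n) true).toReal - (acceptPMF D n (P.S0.outputPMF unaryEncodeNat n) true).toReal| =
      distAdvantage D (fun n => P.S0.outputPMF unaryEncodeNat n) (fun n => P.S1.outputPMF unaryEncodeNat n) n := by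
    rw [distAdvantage, abs_sub_comm]
  rw [hadv_eq] at hmain
  -- the error terms
  have hΔ : (Cx.P.S0.outputPMF unaryEncodeNat Cx.n).tvDist (Cx.P.S1.outputPMF unaryEncodeNat Cx.n) =
      (P.S0.outputPMF unaryEncodeNat n).tvDist (P.S1.outputPMF unaryEncodeNat n) := by rw [hCn]; rfl
  rw [hΔ] at hmain
  have hpd0 : (0 : ℝ) < P.pd.eval n := by exact_mod_cast hpd n
  have hΔ2 : 1 / ((P.pd.eval n : ℕ) : ℝ) ^ 2 < ((P.S0.outputPMF unaryEncodeNat n).tvDist (P.S1.outputPMF unaryEncodeNat n)) ^ 2 := by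
    rw [one_div, ← inv_pow, ← one_div]
    exact pow_lt_pow_left₀ hfarN (by positivity) two_ne_zero
  have herr1 : 8 / 2 ^ Cx.rl * ∑ z ∈ Cx.Zset, Cx.FailSum (Cx.yZ z) < 1 / (4 * ((P.pd.eval n : ℕ) : ℝ) ^ 2) := by
    rw [Cx.sum_FailSum_eq hWF ho', ← mul_assoc, div_mul_cancel₀ _ (by positivity)]
    have hsl : ∑ i ∈ Finset.range (Cx.L + 1), Cx.sliceFail i ≤ (Cx.L + 1) * (2 ^ (2 * Cx.t) * 2 ^ Cx.il * (1 - invertProb Cx.P.F Cx.A Cx.m)) := by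
      calc ∑ i ∈ Finset.range (Cx.L + 1), Cx.sliceFail i
          ≤ ∑ _i ∈ Finset.range (Cx.L + 1), 2 ^ (2 * Cx.t) * 2 ^ Cx.il * (1 - invertProb Cx.P.F Cx.A Cx.m) :=
            Finset.sum_le_sum fun i hi => Cx.sliceFail_le hWF (Nat.lt_succ_iff.1 (Finset.mem_range.1 hi))
        _ = _ := by rw [Finset.sum_const, Finset.card_range, nsmul_eq_mul]; push_cast; ring
    have herr' : 8 * (Cx.L + 1) * 2 ^ (2 * Cx.t) * 2 ^ Cx.il * (1 - invertProb P.F A (mf n)) < 1 / (4 * ((P.pd.eval n : ℕ) : ℝ) ^ 2) := by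
      simpa only [hCn] using herr
    calc (8 : ℝ) * ∑ i ∈ Finset.range (Cx.L + 1), Cx.sliceFail i
        ≤ 8 * ((Cx.L + 1) * (2 ^ (2 * Cx.t) * 2 ^ Cx.il * (1 - invertProb Cx.P.F Cx.A Cx.m))) := by linarith
      _ = 8 * (Cx.L + 1) * 2 ^ (2 * Cx.t) * 2 ^ Cx.il * (1 - invertProb P.F A (mf n)) := by
          show _ = 8 * (Cx.L + 1) * 2 ^ (2 * Cx.t) * 2 ^ Cx.il * (1 - invertProb Cx.P.F Cx.A Cx.m); ring
      _ < _ := herr'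
  have herr2 : 2 * (2 / (2 : ℝ) ^ Cx.gl + Real.exp (-(Cx.N : ℝ))) ≤ 1 / (4 * ((P.pd.eval n : ℕ) : ℝ) ^ 2) := by
    have := err_scan_le hWF hN12 hpd; rwa [hCn] at this
  -- the contradiction: `2 pd² · adv ≥ 1`
  have hge : 1 ≤ (((C 2 * P.pd ^ 2).eval n : ℕ) : ℝ) *
      distAdvantage D (fun n => P.S0.outputPMF unaryEncodeNat n) (fun n => P.S1.outputPMF unaryEncodeNat n) n := by
    have e : (((C 2 * P.pd ^ 2).eval n : ℕ) : ℝ) = 2 * ((P.pd.eval n : ℕ) : ℝ) ^ 2 := by simp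
    rw [e]
    have h14 : 1 / (4 * ((P.pd.eval n : ℕ) : ℝ) ^ 2) = (1 / ((P.pd.eval n : ℕ) : ℝ) ^ 2) / 4 := by field_simp
    have hadvge : 1 / ((P.pd.eval n : ℕ) : ℝ) ^ 2 / 2 ≤
        distAdvantage D (fun n => P.S0.outputPMF unaryEncodeNat n) (fun n => P.S1.outputPMF unaryEncodeNat n) n := by
      linarith
    have : 1 = 2 * ((P.pd.eval n : ℕ) : ℝ) ^ 2 * (1 / ((P.pd.eval n : ℕ) : ℝ) ^ 2 / 2) := by field_simp
    rw [this]
    exact mul_le_mul_of_nonneg_left hadvge (by positivity)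
  linarith

/-! ### From the hypotheses of the named fact to the data `P` -/

/-- **Polynomial output length of a polynomial-time function** (general encoders; private copy of
`PolyTimeComputable.exists_length_le`, `HeuristicClassesHeurBPPReductionProofs.lean`). [cite: AroraBarak2009, §1.3] -/
private theorem exists_length_le' {α β Γ₀ Γ₁ : Type} {ea : α → List Γ₀} {eb : β → List Γ₁} {g : α → β}
    (hg : PolyTimeComputable ea eb g) : ∃ q : Polynomial ℕ, ∀ a, (eb (g a)).length ≤ q.eval (ea a).length := by
  obtain ⟨p, M, hM⟩ := hg
  refine ⟨X + C (TM2Comp.machinePushBound M.tm) * p, fun a => ?_⟩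
  have h := (hM a).length_le
  simpa using h

/-- A polynomial-time sampler has polynomially bounded output length on polynomially many coins. [folklore] -/
theorem exists_output_bound {S : RandAlg ℕ (List Bool)} (hS : S.IsPolyTime unaryEncodeNat id) (pc : Polynomial ℕ) :
    ∃ po : Polynomial ℕ, ∀ (n : ℕ) (r : List Bool), r.length ≤ pc.eval n → (S.run n r).length ≤ po.eval n := by
  obtain ⟨q, hq⟩ := exists_length_le' hS.1
  refine ⟨q.comp (C 2 * X + C 2 + pc), fun n r hr => ?_⟩
  have h := hq (n, r)
  simp only [Function.uncurry_apply_pair, id, length_boolPair] at h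
  rw [eval_comp]
  refine h.trans (natPoly_eval_mono _ ?_)
  simp [Complexity.unaryEncodeNat_eq_replicate]
  omega

/-- **The reduction from the hypotheses of the named fact**, with the efficiency of the distinguishers as a
hypothesis: two exactly polynomial-time samplable ensembles that are computationally indistinguishable and
statistically far apart (`Δ > 1/p(n)` eventually, for a positive polynomial `p`) give a weak one-way function.
[cite: Goldreich2001, §3.8 Exercise 11; Goldreich2010, Exercise 2.8] -/
theorem weakOWFExist_of_samplers (X Y : ℕ → PMF (List Bool)) (hX : MetaComplexity.Ensemble.IsPolySamplable X)
    (hY : MetaComplexity.Ensemble.IsPolySamplable Y) (hind : IsCompIndistinguishable X Y)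
    (hfar : ∃ p : Polynomial ℕ, (∀ n, 0 < p.eval n) ∧ ∀ᶠ n in atTop, 1 / ((p.eval n : ℕ) : ℝ) < (X n).tvDist (Y n))
    (hD : ∀ (P : Params) (Ad : Adv) (cl : ℕ → ℕ), P.S0.IsPolyTime unaryEncodeNat id → P.S1.IsPolyTime unaryEncodeNat id →
      IsPPT Ad.A id → (∃ pc : Polynomial ℕ, ∀ L, cl L ≤ pc.eval L) → IsPPT (P.dist Ad cl) encodeBool) :
    WeakOWFExist := by
  obtain ⟨S0, hS0t, hS0⟩ := hX
  obtain ⟨S1, hS1t, hS1⟩ := hY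
  obtain ⟨p0, hp0⟩ := hS0t.2
  obtain ⟨p1, hp1⟩ := hS1t.2
  obtain ⟨po0, hpo0⟩ := exists_output_bound hS0t (p0 + p1)
  obtain ⟨po1, hpo1⟩ := exists_output_bound hS1t (p0 + p1)
  obtain ⟨pd, hpd, hev⟩ := hfar
  let P : Params := ⟨S0, S1, p0 + p1, po0 + po1, pd⟩
  have hc : ∀ σ n, P.ell σ n ≤ P.pc.eval n := by
    intro σ n; cases σ
    · show S0.coinLen n ≤ (p0 + p1).eval n; rw [eval_add]; exact (hp0 n).trans (Nat.le_add_right _ _)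
    · show S1.coinLen n ≤ (p0 + p1).eval n; rw [eval_add]; exact (hp1 n).trans (Nat.le_add_left _ _)
  have ho : ∀ (σ : Bool) (n : ℕ) (r : List Bool), r.length ≤ P.pc.eval n → ((P.S σ).run n r).length ≤ P.po.eval n := by
    intro σ n r hr; cases σ
    · show (S0.run n r).length ≤ (po0 + po1).eval n; rw [eval_add]; exact (hpo0 n r hr).trans (Nat.le_add_right _ _)
    · show (S1.run n r).length ≤ (po0 + po1).eval n; rw [eval_add]; exact (hpo1 n r hr).trans (Nat.le_add_left _ _)
  have hXe : (fun n => P.S0.outputPMF unaryEncodeNat n) = X := funext hS0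
  have hYe : (fun n => P.S1.outputPMF unaryEncodeNat n) = Y := funext hS1
  have hfar' : ∀ᶠ n in atTop, 1 / ((P.pd.eval n : ℕ) : ℝ) < (P.S0.outputPMF unaryEncodeNat n).tvDist (P.S1.outputPMF unaryEncodeNat n) := by
    filter_upwards [hev] with n hn
    rw [show P.S0.outputPMF unaryEncodeNat n = X n from hS0 n, show P.S1.outputPMF unaryEncodeNat n = Y n from hS1 n]
    exact hn
  have hind' : IsCompIndistinguishable (fun n => P.S0.outputPMF unaryEncodeNat n) (fun n => P.S1.outputPMF unaryEncodeNat n) := by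
    rw [hXe, hYe]; exact hind
  exact ⟨P.F, isWeaklyOneWay_F P hc ho (FProg2.F_polyTime hS0t hS1t) hpd hfar' hind' (fun Ad cl hA hcl => hD P Ad cl hS0t hS1t hA hcl)⟩

end Params

end FarApartOWF

end

end Literature.Computability.Cryptography

/-!
## Part VII — the distinguisher is PPT

Part VII of the discharge of `Goldreich2001_owfExist_of_indistinguishable_farApart` (Goldreich 2001, §3.8
Exercise 11). It discharges the efficiency hypothesis of `Params.isWeaklyOneWay_F`
(Part VI above): for a PPT inverter `A` and a polynomially bounded budget `cl`,
the distinguisher `P.dist Ad cl` (Part V above) is PPT (`DProg.dist_isPPT`).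
As everywhere in the tree this is brick algebra (Arora–Barak 2009, §1.3–1.4), no machine being programmed:

* Stage 1 (`DProg.initU`): from the machine input `⟨w, r⟩`, decode the advice `(m, ℓ₀, ℓ₁, κ)` from `|r|` in
  base `B(|w|)` by four unary divisions (`divModFn`), compute the level data in unary
  (`FProg2.lvlF`, HILL's `nU`/`hU`/`eU`, `FProg.tU`, `2^{eLen N + 1}` by `binToUnaryFn` on `0^{eLen N+1} 1`,
  products by `umulFn`), the image `y = bits ℓ₀ ‖ bits ℓ₁ ‖ enc z` (`lenBinF`, `FProg.capU`/`WU`), and assemble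
  the loop record `⟨x, ⟨bin M, ⟨0, 0⟩⟩⟩` (`x` holds `r`, the twelve unary parameters and `y`);
* Stage 2 (`DProg.bodyF`, `Brick.loopStep`): one round = one attempt — the round with counter `k` handles
  attempt `a = M − k` (level `L − a/T`, coin block `(r ⇂ a·blk) ↾ blk`), builds the query, runs `A`
  (`LenPres.bFn`), tests validity with `F` itself (`F ∈ FP`, `FProg2.F_polyTime`) and `eqPairFn`, and records
  the first valid selector bit in the state `⟨flag, bit⟩`;
* Stage 3 (`DProg.outF`): the recorded bit, or the fresh coin `r[M·blk]` if no attempt was valid;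
* `DProg.DF_apply`: the pipeline computes `encodeBool (dRun w r)` on EVERY input (the loop is clocked by
  `|x| ≥ M` rounds; its model is the first-success scan, `scan_eq_firstOpt`), whence `dist_isPPT`.

## References

* S. Arora, B. Barak, *Computational Complexity: A Modern Approach*, CUP 2009, §1.3 (composition, bounded
  loops), §1.4.1 (clocked simulation), §7.1 (machines with a random tape).
* O. Goldreich, *Foundations of Cryptography I*, CUP 2001, §1.3.2 (probabilistic polynomial time).
-/

namespace Literature.Computability.Cryptography

open Filter Finset Polynomial _root_.Computability Complexity AffineStr HILL

noncomputable section

namespace FarApartOWF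

namespace DProg

open Complexity.Brick Complexity.Plumb Complexity.OracleCompose Complexity.HashBricks

variable (P : Params) (Ad : Adv)

/-! ### Stage 1: decoding and the parameters, on the machine input `⟨w, r⟩` -/

/-- `1^B`, `B = B(|w|)`. [folklore] -/
def BU : List Bool → List Bool := polyFn (P.Bpoly Ad) ∘ fstF
/-- `1^{|r|}`. [folklore] -/
def cU : List Bool → List Bool := onesFn ∘ sndF
/-- `1^{|r|/B}`. [folklore] -/
def q1U : List Bool → List Bool := fstF ∘ divModFn ∘ fanoutFn (BU P Ad) cU
/-- `⟨1^{|r|/B/B}, 1^m⟩`. [folklore] -/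
def dm2 : List Bool → List Bool := divModFn ∘ fanoutFn (BU P Ad) (q1U P Ad)
/-- `1^m`. [folklore] -/
def mU : List Bool → List Bool := sndF ∘ dm2 P Ad
/-- `⟨1^{|r|/B/B/B}, 1^{ℓ₀}⟩`. [folklore] -/
def dm3 : List Bool → List Bool := divModFn ∘ fanoutFn (BU P Ad) (fstF ∘ dm2 P Ad)
/-- `1^{ℓ₀}`. [folklore] -/
def l0U : List Bool → List Bool := sndF ∘ dm3 P Ad
/-- `⟨1^κ, 1^{ℓ₁}⟩`. [folklore] -/
def dm4 : List Bool → List Bool := divModFn ∘ fanoutFn (BU P Ad) (fstF ∘ dm3 P Ad)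
/-- `1^{ℓ₁}`. [folklore] -/
def l1U : List Bool → List Bool := sndF ∘ dm4 P Ad
/-- `1^κ`. [folklore] -/
def kapU : List Bool → List Bool := fstF ∘ dm4 P Ad
/-- `1^N`, `N = lvl m`. [folklore] -/
def NU : List Bool → List Bool := FProg2.lvlF ∘ mU P Ad
/-- `⟨1^N, ε⟩` (the argument shape of HILL's level bricks). [folklore] -/
def NP : List Bool → List Bool := fanoutFn (NU P Ad) (fun _ => [])
/-- `1^L`, `L = nLen N`. [folklore] -/
def LU : List Bool → List Bool := nU ∘ NP P Ad
/-- `1^{hLen N}`. [folklore] -/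
def hLU : List Bool → List Bool := hU ∘ NP P Ad
/-- `1^{eLen N}`. [folklore] -/
def eLU : List Bool → List Bool := eU ∘ NP P Ad
/-- `1^t`, `t = tLen (nPar L)`. [folklore] -/
def tUU : List Bool → List Bool := FProg.tU P ∘ LU P Ad
/-- `1^{il}`, `il = N − L`. [folklore] -/
def ilU : List Bool → List Bool := dropFn ∘ fanoutFn (LU P Ad) (NU P Ad)
/-- `1^{klen}`, `klen = m − N`. [folklore] -/
def klU : List Bool → List Bool := dropFn ∘ fanoutFn (NU P Ad) (mU P Ad)
/-- `1^{blk}`, `blk = klen + hLen N + κ`. [folklore] -/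
def blkU : List Bool → List Bool := concatFn ∘ fanoutFn (concatFn ∘ fanoutFn (klU P Ad) (hLU P Ad)) (kapU P Ad)
/-- The ruler polynomial of the power `2^{eLen N + 1} ≤ 32 (2N+2)²`. [folklore] -/
def Rp : Polynomial ℕ := C 32 * (C 2 * X + C 2) ^ 2
/-- `1^{2^{eLen N + 1}}` (binary numeral `0^{eLen N + 1} 1` converted under the ruler `1^{Rp(N)}`). [folklore] -/
def powU : List Bool → List Bool :=
  binToUnaryFn ∘ fanoutFn (polyFn Rp ∘ NU P Ad)
    (concatFn ∘ fanoutFn (Kannan.zerosFn ∘ concatFn ∘ fanoutFn (eLU P Ad) (fun _ => [true])) (fun _ => [true]))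
/-- `1^T`, `T = N · 2^{eLen N + 1}`. [folklore] -/
def TU : List Bool → List Bool := umulFn ∘ fanoutFn (NU P Ad) (powU P Ad)
/-- `1^M`, `M = (L + 1) T`. [folklore] -/
def MU : List Bool → List Bool := umulFn ∘ fanoutFn (concatFn ∘ fanoutFn (LU P Ad) (fun _ => [true])) (TU P Ad)
/-- `z = (boolUnpair w).2`. [folklore] -/
def zF : List Bool → List Bool := sndF ∘ fstF
/-- The `t`-bit code of a unary value: `bin v ‖ 0^{t − |bin v|}`. [folklore] -/
def bitsTU (v : List Bool → List Bool) : List Bool → List Bool :=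
  concatFn ∘ fanoutFn (lenBinF ∘ v) (Kannan.zerosFn ∘ dropFn ∘ fanoutFn (lenBinF ∘ v) (tUU P Ad))
/-- The capped sample `z ↾ cap`. [folklore] -/
def zcU : List Bool → List Bool := takeFn ∘ fanoutFn (FProg.capU P ∘ LU P Ad) (zF)
/-- The padding of the code field. [folklore] -/
def padU : List Bool → List Bool :=
  Kannan.zerosFn ∘ dropFn ∘ fanoutFn (concatFn ∘ fanoutFn (concatFn ∘ fanoutFn (onesFn ∘ zcU P Ad) (onesFn ∘ zcU P Ad)) (fun _ => ones 2))
    (FProg.WU P ∘ LU P Ad)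
/-- `enc n L z`. [folklore] -/
def encU : List Bool → List Bool := fanoutFn (zcU P Ad) (padU P Ad)
/-- **The image `y = bits ℓ₀ ‖ bits ℓ₁ ‖ enc z`.** [folklore] -/
def yU : List Bool → List Bool := concatFn ∘ fanoutFn (concatFn ∘ fanoutFn (bitsTU P Ad (l0U P Ad)) (bitsTU P Ad (l1U P Ad))) (encU P Ad)
/-- **The record `x`** = `⟨r, 1^m, 1^L, 1^t, 1^{il}, 1^{klen}, 1^{hLen}, 1^{eLen}, 1^κ, 1^{blk}, 1^T, 1^M, y⟩`. [folklore] -/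
def xU : List Bool → List Bool :=
  fanoutFn sndF (fanoutFn (mU P Ad) (fanoutFn (LU P Ad) (fanoutFn (tUU P Ad) (fanoutFn (ilU P Ad) (fanoutFn (klU P Ad)
    (fanoutFn (hLU P Ad) (fanoutFn (eLU P Ad) (fanoutFn (kapU P Ad) (fanoutFn (blkU P Ad) (fanoutFn (TU P Ad)
      (fanoutFn (MU P Ad) (yU P Ad))))))))))))
/-- **The initial loop record** `⟨x, ⟨bin M, ⟨0, 0⟩⟩⟩`. [folklore] -/
def initU : List Bool → List Bool := fanoutFn (xU P Ad) (fanoutFn (lenBinF ∘ MU P Ad) (fun _ => boolPair [false] [false]))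

/-! ### Stage 2: one attempt as the body of the counted loop -/

/-- Field `i` of the record `x` inside the loop record `⟨x, ⟨counter, state⟩⟩`. [folklore] -/
def fld (i : ℕ) : List Bool → List Bool := nthF i ∘ fstF
/-- The image `y` (the last field of `x`). [folklore] -/
def yA : List Bool → List Bool := sndPow 11 ∘ fstF
/-- `1^k` (the counter in unary, ruler `1^M`). [folklore] -/
def kU : List Bool → List Bool := binToUnaryFn ∘ fanoutFn (fld 11) (nthF 1)
/-- `1^a`, `a = M − k` (the attempt index). [folklore] -/
def aU : List Bool → List Bool := dropFn ∘ fanoutFn kU (fld 11)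
/-- `1^{a/T}`. [folklore] -/
def qU : List Bool → List Bool := fstF ∘ divModFn ∘ fanoutFn (fld 10) aU
/-- `1^i`, `i = L − a/T` (the level of the attempt). [folklore] -/
def iU : List Bool → List Bool := dropFn ∘ fanoutFn qU (fld 2)
/-- The coin block `(r ⇂ a·blk) ↾ blk`. [folklore] -/
def blockU : List Bool → List Bool := takeFn ∘ fanoutFn (fld 9) (dropFn ∘ fanoutFn (umulFn ∘ fanoutFn aU (fld 9)) (fld 0))
/-- The key `ρ`. [folklore] -/
def ρU : List Bool → List Bool := takeFn ∘ fanoutFn (fld 5) blockU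
/-- The target `α`. [folklore] -/
def αU : List Bool → List Bool := takeFn ∘ fanoutFn (fld 6) (dropFn ∘ fanoutFn (fld 5) blockU)
/-- `A`'s coins. [folklore] -/
def rAU : List Bool → List Bool := takeFn ∘ fanoutFn (fld 8) (dropFn ∘ fanoutFn (concatFn ∘ fanoutFn (fld 5) (fld 6)) blockU)
/-- The index block `ι_i = bin i ‖ 0^{il − |bin i|}`. [folklore] -/
def ιU : List Bool → List Bool := concatFn ∘ fanoutFn (lenBinF ∘ iU) (Kannan.zerosFn ∘ dropFn ∘ fanoutFn (lenBinF ∘ iU) (fld 4))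
/-- `1^{i + eLen N}`. [folklore] -/
def ieU : List Bool → List Bool := concatFn ∘ fanoutFn iU (fld 7)
/-- The masked target `maskTo_N^i(α)`. [folklore] -/
def maskU : List Bool → List Bool := concatFn ∘ fanoutFn (takeFn ∘ fanoutFn ieU αU) (Kannan.zerosFn ∘ dropFn ∘ fanoutFn ieU (fld 6))
/-- The query body `y ‖ mask ‖ ι ‖ ρ`. [folklore] -/
def bodyQU : List Bool → List Bool := concatFn ∘ fanoutFn (concatFn ∘ fanoutFn (concatFn ∘ fanoutFn yA maskU) ιU) ρU
/-- The query `⟨1^m, body⟩`. [folklore] -/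
def qryU : List Bool → List Bool := fanoutFn (fld 1) bodyQU
/-- The inverter's answer. [folklore] -/
def ansU : List Bool → List Bool := LenPres.bFn Ad.A ∘ fanoutFn qryU rAU
/-- The validity bit `[F(answer) = body]`. [folklore] -/
def validC : List Bool → List Bool := eqPairFn ∘ fanoutFn (P.F ∘ ansU Ad) bodyQU
/-- The selector bit of the answer, `[answer[2t]]`. [folklore] -/
def bitC : List Bool → List Bool := eqPairFn ∘ fanoutFn (bitAtFn ∘ fanoutFn (concatFn ∘ fanoutFn (fld 3) (fld 3)) (ansU Ad)) (fun _ => [true])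
/-- The flag of the state. [folklore] -/
def flagC : List Bool → List Bool := eqPairFn ∘ fanoutFn (nthF 2) (fun _ => [true])
/-- **The body**: keep a set state; otherwise record the attempt's bit if it is valid. [folklore] -/
def bodyF : List Bool → List Bool := iteFn flagC (sndPow 1) (iteFn (validC P Ad) (fanoutFn (fun _ => [true]) (bitC Ad)) (sndPow 1))

/-! ### Stage 3: the output -/

/-- The fresh coin `r[M · blk]` (as a bit). [folklore] -/
def coinC : List Bool → List Bool := eqPairFn ∘ fanoutFn (bitAtFn ∘ fanoutFn (umulFn ∘ fanoutFn (fld 11) (fld 9)) (fld 0)) (fun _ => [true])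
/-- The output bit. [folklore] -/
def outF : List Bool → List Bool := iteFn flagC (sndPow 2) coinC
/-- The clocked loop (`|x| ≥ M` rounds). [folklore] -/
def loopF : List Bool → List Bool := fun z => (loopStep (bodyF P Ad))^[X.eval (fstF z).length] z
/-- **The whole program for `D`.** [folklore] -/
def DF : List Bool → List Bool := outF ∘ loopF P Ad ∘ initU P Ad

/-! ### Membership in `FP` -/

variable {P Ad}

/-- The stage-1 bricks are in `FP`. [Arora–Barak 2009, §1.3] [folklore] -/
theorem initU_mem_FP : initU P Ad ∈ FP := by
  have hB : BU P Ad ∈ FP := comp_mem_FP (polyFn_mem_FP _) fstF_mem_FP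
  have hc : cU ∈ FP := comp_mem_FP onesFn_mem_FP sndF_mem_FP
  have hq1 : q1U P Ad ∈ FP := comp_mem_FP fstF_mem_FP (comp_mem_FP divModFn_mem_FP (fanoutFn_mem_FP hB hc))
  have hdm2 : dm2 P Ad ∈ FP := comp_mem_FP divModFn_mem_FP (fanoutFn_mem_FP hB hq1)
  have hm : mU P Ad ∈ FP := comp_mem_FP sndF_mem_FP hdm2
  have hdm3 : dm3 P Ad ∈ FP := comp_mem_FP divModFn_mem_FP (fanoutFn_mem_FP hB (comp_mem_FP fstF_mem_FP hdm2))
  have hl0 : l0U P Ad ∈ FP := comp_mem_FP sndF_mem_FP hdm3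
  have hdm4 : dm4 P Ad ∈ FP := comp_mem_FP divModFn_mem_FP (fanoutFn_mem_FP hB (comp_mem_FP fstF_mem_FP hdm3))
  have hl1 : l1U P Ad ∈ FP := comp_mem_FP sndF_mem_FP hdm4
  have hkap : kapU P Ad ∈ FP := comp_mem_FP fstF_mem_FP hdm4
  have hN : NU P Ad ∈ FP := comp_mem_FP (FProg.searchF_mem_FP _) hm
  have hNP : NP P Ad ∈ FP := fanoutFn_mem_FP hN (const_mem_FP _)
  have hbU : bU ∈ FP := comp_mem_FP (cons_mem_FP true) (comp_mem_FP logFn_mem_FP fstF_mem_FP)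
  have hnU : nU ∈ FP := comp_mem_FP dropFn_mem_FP (fanoutFn_mem_FP hbU fstF_mem_FP)
  have heU : eU ∈ FP := comp_mem_FP concatFn_mem_FP (fanoutFn_mem_FP (comp_mem_FP concatFn_mem_FP (fanoutFn_mem_FP hbU hbU)) (const_mem_FP _))
  have hhU : hU ∈ FP := comp_mem_FP concatFn_mem_FP (fanoutFn_mem_FP hnU heU)
  have hL : LU P Ad ∈ FP := comp_mem_FP hnU hNP
  have hhL : hLU P Ad ∈ FP := comp_mem_FP hhU hNP
  have heL : eLU P Ad ∈ FP := comp_mem_FP heU hNP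
  have hsearch : FProg.nF P ∈ FP := FProg.nF_mem_FP P
  have htU : FProg.tU P ∈ FP := comp_mem_FP (cons_mem_FP true) (comp_mem_FP logFn_mem_FP (comp_mem_FP (polyFn_mem_FP _) hsearch))
  have httU : FProg.ttU P ∈ FP := comp_mem_FP concatFn_mem_FP (fanoutFn_mem_FP htU htU)
  have hWU : FProg.WU P ∈ FP := comp_mem_FP dropFn_mem_FP (fanoutFn_mem_FP httU onesFn_mem_FP)
  have hcapU : FProg.capU P ∈ FP := comp_mem_FP halfFn_mem_FP (comp_mem_FP dropFn_mem_FP (fanoutFn_mem_FP (const_mem_FP _) hWU))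
  have ht : tUU P Ad ∈ FP := comp_mem_FP htU hL
  have hil : ilU P Ad ∈ FP := comp_mem_FP dropFn_mem_FP (fanoutFn_mem_FP hL hN)
  have hkl : klU P Ad ∈ FP := comp_mem_FP dropFn_mem_FP (fanoutFn_mem_FP hN hm)
  have hblk : blkU P Ad ∈ FP := comp_mem_FP concatFn_mem_FP (fanoutFn_mem_FP (comp_mem_FP concatFn_mem_FP (fanoutFn_mem_FP hkl hhL)) hkap)
  have hpow : powU P Ad ∈ FP := comp_mem_FP binToUnaryFn_mem_FP (fanoutFn_mem_FP (comp_mem_FP (polyFn_mem_FP _) hN)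
    (comp_mem_FP concatFn_mem_FP (fanoutFn_mem_FP (comp_mem_FP Kannan.zerosFn_mem_FP (comp_mem_FP concatFn_mem_FP
      (fanoutFn_mem_FP heL (const_mem_FP _)))) (const_mem_FP _))))
  have hT : TU P Ad ∈ FP := comp_mem_FP umulFn_mem_FP (fanoutFn_mem_FP hN hpow)
  have hM : MU P Ad ∈ FP := comp_mem_FP umulFn_mem_FP (fanoutFn_mem_FP (comp_mem_FP concatFn_mem_FP (fanoutFn_mem_FP hL (const_mem_FP _))) hT)
  have hz : zF ∈ FP := comp_mem_FP sndF_mem_FP fstF_mem_FP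
  have hbits : ∀ {v : List Bool → List Bool}, v ∈ FP → bitsTU P Ad v ∈ FP := fun hv =>
    comp_mem_FP concatFn_mem_FP (fanoutFn_mem_FP (comp_mem_FP lenBinF_mem_FP hv) (comp_mem_FP Kannan.zerosFn_mem_FP
      (comp_mem_FP dropFn_mem_FP (fanoutFn_mem_FP (comp_mem_FP lenBinF_mem_FP hv) ht))))
  have hzc : zcU P Ad ∈ FP := comp_mem_FP takeFn_mem_FP (fanoutFn_mem_FP (comp_mem_FP hcapU hL) hz)
  have hpad : padU P Ad ∈ FP := comp_mem_FP Kannan.zerosFn_mem_FP (comp_mem_FP dropFn_mem_FP (fanoutFn_mem_FP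
    (comp_mem_FP concatFn_mem_FP (fanoutFn_mem_FP (comp_mem_FP concatFn_mem_FP (fanoutFn_mem_FP
      (comp_mem_FP onesFn_mem_FP hzc) (comp_mem_FP onesFn_mem_FP hzc))) (const_mem_FP _))) (comp_mem_FP hWU hL)))
  have henc : encU P Ad ∈ FP := fanoutFn_mem_FP hzc hpad
  have hy : yU P Ad ∈ FP := comp_mem_FP concatFn_mem_FP (fanoutFn_mem_FP (comp_mem_FP concatFn_mem_FP (fanoutFn_mem_FP (hbits hl0) (hbits hl1))) henc)
  have hx : xU P Ad ∈ FP := fanoutFn_mem_FP sndF_mem_FP (fanoutFn_mem_FP hm (fanoutFn_mem_FP hL (fanoutFn_mem_FP ht (fanoutFn_mem_FP hil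
    (fanoutFn_mem_FP hkl (fanoutFn_mem_FP hhL (fanoutFn_mem_FP heL (fanoutFn_mem_FP hkap (fanoutFn_mem_FP hblk (fanoutFn_mem_FP hT
      (fanoutFn_mem_FP hM hy)))))))))))
  exact fanoutFn_mem_FP hx (fanoutFn_mem_FP (comp_mem_FP lenBinF_mem_FP hM) (const_mem_FP _))

/-- The body is in `FP`. [Arora–Barak 2009, §1.3] [folklore] -/
theorem bodyF_mem_FP (h0 : P.S0.IsPolyTime unaryEncodeNat id) (h1 : P.S1.IsPolyTime unaryEncodeNat id) (hA : IsPPT Ad.A id) :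
    bodyF P Ad ∈ FP := by
  have hfld : ∀ i, fld i ∈ FP := fun i => comp_mem_FP (nthF_mem_FP i) fstF_mem_FP
  have hyA : yA ∈ FP := comp_mem_FP (sndPow_mem_FP 11) fstF_mem_FP
  have hk : kU ∈ FP := comp_mem_FP binToUnaryFn_mem_FP (fanoutFn_mem_FP (hfld 11) (nthF_mem_FP 1))
  have ha : aU ∈ FP := comp_mem_FP dropFn_mem_FP (fanoutFn_mem_FP hk (hfld 11))
  have hq : qU ∈ FP := comp_mem_FP fstF_mem_FP (comp_mem_FP divModFn_mem_FP (fanoutFn_mem_FP (hfld 10) ha))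
  have hi : iU ∈ FP := comp_mem_FP dropFn_mem_FP (fanoutFn_mem_FP hq (hfld 2))
  have hblock : blockU ∈ FP := comp_mem_FP takeFn_mem_FP (fanoutFn_mem_FP (hfld 9) (comp_mem_FP dropFn_mem_FP
    (fanoutFn_mem_FP (comp_mem_FP umulFn_mem_FP (fanoutFn_mem_FP ha (hfld 9))) (hfld 0))))
  have hρ : ρU ∈ FP := comp_mem_FP takeFn_mem_FP (fanoutFn_mem_FP (hfld 5) hblock)
  have hα : αU ∈ FP := comp_mem_FP takeFn_mem_FP (fanoutFn_mem_FP (hfld 6) (comp_mem_FP dropFn_mem_FP (fanoutFn_mem_FP (hfld 5) hblock)))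
  have hrA : rAU ∈ FP := comp_mem_FP takeFn_mem_FP (fanoutFn_mem_FP (hfld 8) (comp_mem_FP dropFn_mem_FP
    (fanoutFn_mem_FP (comp_mem_FP concatFn_mem_FP (fanoutFn_mem_FP (hfld 5) (hfld 6))) hblock)))
  have hι : ιU ∈ FP := comp_mem_FP concatFn_mem_FP (fanoutFn_mem_FP (comp_mem_FP lenBinF_mem_FP hi) (comp_mem_FP Kannan.zerosFn_mem_FP
    (comp_mem_FP dropFn_mem_FP (fanoutFn_mem_FP (comp_mem_FP lenBinF_mem_FP hi) (hfld 4)))))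
  have hie : ieU ∈ FP := comp_mem_FP concatFn_mem_FP (fanoutFn_mem_FP hi (hfld 7))
  have hmask : maskU ∈ FP := comp_mem_FP concatFn_mem_FP (fanoutFn_mem_FP (comp_mem_FP takeFn_mem_FP (fanoutFn_mem_FP hie hα))
    (comp_mem_FP Kannan.zerosFn_mem_FP (comp_mem_FP dropFn_mem_FP (fanoutFn_mem_FP hie (hfld 6)))))
  have hbody : bodyQU ∈ FP := comp_mem_FP concatFn_mem_FP (fanoutFn_mem_FP (comp_mem_FP concatFn_mem_FP (fanoutFn_mem_FP
    (comp_mem_FP concatFn_mem_FP (fanoutFn_mem_FP hyA hmask)) hι)) hρ)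
  have hqry : qryU ∈ FP := fanoutFn_mem_FP (hfld 1) hbody
  have hb : LenPres.bFn Ad.A ∈ FP := by
    show PolyTimeComputable id id (Function.uncurry Ad.A.run ∘ boolUnpair)
    exact PolyTimeComputable.comp_holds hA.1 polyTimeComputable_boolUnpair
  have hans : ansU Ad ∈ FP := comp_mem_FP hb (fanoutFn_mem_FP hqry hrA)
  have hF : P.F ∈ FP := FProg2.F_polyTime h0 h1
  have hvalid : validC P Ad ∈ FP := comp_mem_FP eqPairFn_mem_FP (fanoutFn_mem_FP (comp_mem_FP hF hans) hbody)
  have hbit : bitC Ad ∈ FP := comp_mem_FP eqPairFn_mem_FP (fanoutFn_mem_FP (comp_mem_FP bitAtFn_mem_FP (fanoutFn_mem_FP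
    (comp_mem_FP concatFn_mem_FP (fanoutFn_mem_FP (hfld 3) (hfld 3))) hans)) (const_mem_FP _))
  have hflag : flagC ∈ FP := comp_mem_FP eqPairFn_mem_FP (fanoutFn_mem_FP (nthF_mem_FP 2) (const_mem_FP _))
  exact iteFn_mem_FP hflag (sndPow_mem_FP 1) (iteFn_mem_FP hvalid (fanoutFn_mem_FP (const_mem_FP _) hbit) (sndPow_mem_FP 1))

/-- `eqPairFn ∘ ⟨c, [1]⟩` is a one-bit condition. [folklore] -/
theorem eqPairFn_fanout_apply (c : List Bool → List Bool) (z : List Bool) :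
    (eqPairFn ∘ fanoutFn c (fun _ => [true])) z = [decide (c z = [true])] := by
  rw [Function.comp_apply, fanoutFn_apply, eqPairFn_boolPair]

/-- **Growth of the body**: the new state has at most `5` symbols, so `|bodyF z| ≤ |sndPow 1 z| + 5`. [folklore] -/
theorem length_bodyF_le (z : List Bool) : (bodyF P Ad z).length ≤ (sndPow 1 z).length + (C 5 : Polynomial ℕ).eval (fstF z).length := by
  rw [eval_C, bodyF, flagC, iteFn_apply (eqPairFn_fanout_apply _ z)]
  split_ifs
  · omega
  · rw [iteFn_apply (by rw [validC, Function.comp_apply, fanoutFn_apply, eqPairFn_boolPair])]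
    split_ifs
    · rw [fanoutFn_apply, length_boolPair, bitC, eqPairFn_fanout_apply]; simp
    · omega

/-- The loop is in `FP`. [Arora–Barak 2009, §1.3–1.4] [folklore] -/
theorem loopF_mem_FP (h0 : P.S0.IsPolyTime unaryEncodeNat id) (h1 : P.S1.IsPolyTime unaryEncodeNat id) (hA : IsPPT Ad.A id) :
    loopF P Ad ∈ FP :=
  loopFn_mem_FP_of_poly (bodyF_mem_FP h0 h1 hA) (C 5) (length_bodyF_le) X

/-- The output stage is in `FP`. [folklore] -/
theorem outF_mem_FP : outF ∈ FP := by
  have hfld : ∀ i, fld i ∈ FP := fun i => comp_mem_FP (nthF_mem_FP i) fstF_mem_FP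
  have hflag : flagC ∈ FP := comp_mem_FP eqPairFn_mem_FP (fanoutFn_mem_FP (nthF_mem_FP 2) (const_mem_FP _))
  have hcoin : coinC ∈ FP := comp_mem_FP eqPairFn_mem_FP (fanoutFn_mem_FP (comp_mem_FP bitAtFn_mem_FP (fanoutFn_mem_FP
    (comp_mem_FP umulFn_mem_FP (fanoutFn_mem_FP (hfld 11) (hfld 9))) (hfld 0))) (const_mem_FP _))
  exact iteFn_mem_FP hflag (sndPow_mem_FP 2) hcoin

/-- **The whole program is in `FP`.** [Arora–Barak 2009, §1.3–1.4] [folklore] -/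
theorem DF_mem_FP (h0 : P.S0.IsPolyTime unaryEncodeNat id) (h1 : P.S1.IsPolyTime unaryEncodeNat id) (hA : IsPPT Ad.A id) :
    DF P Ad ∈ FP :=
  comp_mem_FP outF_mem_FP (comp_mem_FP (loopF_mem_FP h0 h1 hA) initU_mem_FP)

/-! ### Values of stage 1 on the machine input `⟨w, r⟩` -/

section Values1

variable (P Ad)
variable (w r : List Bool)

/-- The modulus read off the input. [folklore] -/
def Bv : ℕ := (P.Bpoly Ad).eval w.length
/-- The decoded attacked length `m = |r|/B mod B`. [folklore] -/
def mv : ℕ := r.length / Bv P Ad w % Bv P Ad w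
/-- The decoded `ℓ₀`. [folklore] -/
def l0v : ℕ := r.length / Bv P Ad w / Bv P Ad w % Bv P Ad w
/-- The decoded `ℓ₁`. [folklore] -/
def l1v : ℕ := r.length / Bv P Ad w / Bv P Ad w / Bv P Ad w % Bv P Ad w
/-- The decoded `κ`. [folklore] -/
def kapv : ℕ := r.length / Bv P Ad w / Bv P Ad w / Bv P Ad w / Bv P Ad w
/-- The context of the decoded length. [folklore] -/
def Cv : Ctx := P.ctx Ad (mv P Ad w r)
/-- The number of attempts `M = (L + 1) T`. [folklore] -/
def Mv : ℕ := ((Cv P Ad w r).L + 1) * (Cv P Ad w r).T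

variable {P Ad w r}

local notation "z₀" => boolPair w r
local notation "Cw" => Cv P Ad w r

/-- `onesFn v = 1^{|v|}`. [folklore] -/
private theorem onesFn_eq_ones (v : List Bool) : onesFn v = ones v.length := by
  simp [onesFn, Complexity.unaryEncodeNat_eq_replicate, ones]

/-- `ones N = 1^N` as `unaryEncodeNat`. [folklore] -/
private theorem ones_eq_unary (N : ℕ) : ones N = unaryEncodeNat N := by
  simp [Complexity.unaryEncodeNat_eq_replicate, ones]

/-- `|1^n| = n`. [folklore] -/
@[simp] theorem length_ones' (n : ℕ) : (ones n).length = n := by simp [ones]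

/-- `BU ⟨w, r⟩ = 1^B`. [folklore] -/
theorem BU_z : BU P Ad z₀ = ones (Bv P Ad w) := by rw [BU, Function.comp_apply, fstF_boolPair, polyFn_apply, Bv]
/-- `cU ⟨w, r⟩ = 1^{|r|}`. [folklore] -/
theorem cU_z : cU z₀ = ones r.length := by rw [cU, Function.comp_apply, sndF_boolPair, onesFn_eq_ones]
/-- `q1U ⟨w, r⟩ = 1^{|r|/B}`. [folklore] -/
theorem q1U_z : q1U P Ad z₀ = ones (r.length / Bv P Ad w) := by
  rw [q1U, Function.comp_apply, Function.comp_apply, fanoutFn_apply, BU_z, cU_z, divModFn_boolPair, fstF_boolPair]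
/-- Value of `dm2`. [folklore] -/
theorem dm2_z : dm2 P Ad z₀ = boolPair (ones (r.length / Bv P Ad w / Bv P Ad w)) (ones (mv P Ad w r)) := by
  rw [dm2, Function.comp_apply, fanoutFn_apply, BU_z, q1U_z, divModFn_boolPair, mv]
/-- `mU ⟨w, r⟩ = 1^m`. [folklore] -/
theorem mU_z : mU P Ad z₀ = ones (mv P Ad w r) := by rw [mU, Function.comp_apply, dm2_z, sndF_boolPair]
/-- Value of `dm3`. [folklore] -/
theorem dm3_z : dm3 P Ad z₀ = boolPair (ones (r.length / Bv P Ad w / Bv P Ad w / Bv P Ad w)) (ones (l0v P Ad w r)) := by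
  rw [dm3, Function.comp_apply, fanoutFn_apply, BU_z, Function.comp_apply, dm2_z, fstF_boolPair, divModFn_boolPair, l0v]
/-- `l0U ⟨w, r⟩ = 1^{ℓ₀}`. [folklore] -/
theorem l0U_z : l0U P Ad z₀ = ones (l0v P Ad w r) := by rw [l0U, Function.comp_apply, dm3_z, sndF_boolPair]
/-- Value of `dm4`. [folklore] -/
theorem dm4_z : dm4 P Ad z₀ = boolPair (ones (kapv P Ad w r)) (ones (l1v P Ad w r)) := by
  rw [dm4, Function.comp_apply, fanoutFn_apply, BU_z, Function.comp_apply, dm3_z, fstF_boolPair, divModFn_boolPair, kapv, l1v]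
/-- `l1U ⟨w, r⟩ = 1^{ℓ₁}`. [folklore] -/
theorem l1U_z : l1U P Ad z₀ = ones (l1v P Ad w r) := by rw [l1U, Function.comp_apply, dm4_z, sndF_boolPair]
/-- `kapU ⟨w, r⟩ = 1^κ`. [folklore] -/
theorem kapU_z : kapU P Ad z₀ = ones (kapv P Ad w r) := by rw [kapU, Function.comp_apply, dm4_z, fstF_boolPair]
/-- `NU ⟨w, r⟩ = 1^N`. [folklore] -/
theorem NU_z : NU P Ad z₀ = ones (Cw).N := by rw [NU, Function.comp_apply, mU_z, FProg2.lvlF_apply, length_ones']; rfl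
/-- `NP ⟨w, r⟩ = ⟨1^N, ε⟩`. [folklore] -/
theorem NP_z : NP P Ad z₀ = boolPair (unaryEncodeNat (Cw).N) [] := by rw [NP, fanoutFn_apply, NU_z, ones_eq_unary]
/-- `LU ⟨w, r⟩ = 1^L`. [folklore] -/
theorem LU_z : LU P Ad z₀ = ones (Cw).L := by rw [LU, Function.comp_apply, NP_z, nU_pair]; rfl
/-- `hLU ⟨w, r⟩ = 1^{hLen N}`. [folklore] -/
theorem hLU_z : hLU P Ad z₀ = ones (hLen (Cw).N) := by rw [hLU, Function.comp_apply, NP_z, hU_pair]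
/-- `eLU ⟨w, r⟩ = 1^{eLen N}`. [folklore] -/
theorem eLU_z : eLU P Ad z₀ = ones (eLen (Cw).N) := by rw [eLU, Function.comp_apply, NP_z, eU_pair]
/-- `tUU ⟨w, r⟩ = 1^t`. [folklore] -/
theorem tUU_z : tUU P Ad z₀ = ones (Cw).t := by rw [tUU, Function.comp_apply, LU_z, FProg.tU_apply, length_ones']; rfl
/-- `ilU ⟨w, r⟩ = 1^{il}`. [folklore] -/
theorem ilU_z : ilU P Ad z₀ = ones (Cw).il := by rw [ilU, Function.comp_apply, fanoutFn_apply, LU_z, NU_z, dropFn_boolPair]; simp [ones]; rfl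
/-- `klU ⟨w, r⟩ = 1^{klen}`. [folklore] -/
theorem klU_z : klU P Ad z₀ = ones (Cw).klen := by
  rw [klU, Function.comp_apply, fanoutFn_apply, NU_z, mU_z, dropFn_boolPair]; simp [ones]; rfl
/-- `blkU ⟨w, r⟩ = 1^{blk}`. [folklore] -/
theorem blkU_z : blkU P Ad z₀ = ones ((Cw).blk (kapv P Ad w r)) := by
  rw [blkU, Function.comp_apply, fanoutFn_apply, Function.comp_apply, fanoutFn_apply, klU_z, hLU_z, kapU_z, concatFn_boolPair,
    concatFn_boolPair, Com.ones_append, Com.ones_append, Ctx.blk]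
/-- `powU ⟨w, r⟩ = 1^{2^{eLen N + 1}}`. [folklore] -/
theorem powU_z : powU P Ad z₀ = ones (2 ^ (eLen (Cw).N + 1)) := by
  rw [powU, Function.comp_apply, fanoutFn_apply, Function.comp_apply, NU_z, polyFn_apply, length_ones', Function.comp_apply, fanoutFn_apply,
    Function.comp_apply, Function.comp_apply, fanoutFn_apply, eLU_z, concatFn_boolPair, Kannan.zerosFn_apply, concatFn_boolPair,
    binToUnaryFn_boolPair, length_ones']
  have hpow2 : ∀ k : ℕ, bitsToNat (List.replicate k false ++ [true]) = 2 ^ k := by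
    intro k
    induction k with
    | zero => simp [bitsToNat]
    | succ k ih => rw [List.replicate_succ, List.cons_append, bitsToNat, ih, pow_succ]; simp; ring
  have hval : bitsToNat (List.replicate (ones (eLen (Cw).N) ++ [true]).length false ++ [true]) = 2 ^ (eLen (Cw).N + 1) := by
    rw [List.length_append, length_ones', List.length_singleton, hpow2]
  rw [hval, min_eq_left]
  have := Params.two_pow_eLen_succ_le (Cw).N
  simpa [Rp] using this
/-- `TU ⟨w, r⟩ = 1^T`. [folklore] -/
theorem TU_z : TU P Ad z₀ = ones (Cw).T := by
  rw [TU, Function.comp_apply, umulFn_apply, fanoutFn_apply, fstF_boolPair, sndF_boolPair, NU_z, powU_z, length_ones', length_ones', Ctx.T]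
/-- `MU ⟨w, r⟩ = 1^M`. [folklore] -/
theorem MU_z : MU P Ad z₀ = ones (Mv P Ad w r) := by
  rw [MU, Function.comp_apply, umulFn_apply, fanoutFn_apply, fstF_boolPair, sndF_boolPair, Function.comp_apply, fanoutFn_apply, LU_z,
    concatFn_boolPair, TU_z, List.length_append, length_ones', List.length_singleton, length_ones', Mv]
/-- `zF ⟨w, r⟩ = (boolUnpair w).2`. [folklore] -/
theorem zF_z : zF z₀ = (boolUnpair w).2 := by rw [zF, Function.comp_apply, fstF_boolPair]; rfl
/-- `bitsTU v ⟨w, r⟩` is the `t`-bit code of the value of `v`. [folklore] -/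
theorem bitsTU_z {v : List Bool → List Bool} {val : ℕ} (hv : v z₀ = ones val) : bitsTU P Ad v z₀ = Params.bitsT (Cw).t val := by
  rw [bitsTU, Function.comp_apply, fanoutFn_apply, Function.comp_apply, hv, lenBinF_apply, length_ones', Function.comp_apply, Function.comp_apply,
    fanoutFn_apply, Function.comp_apply, hv, lenBinF_apply, length_ones', tUU_z, dropFn_boolPair, Kannan.zerosFn_apply, concatFn_boolPair,
    Params.bitsT, List.length_drop, length_ones']
/-- The capped sample. [folklore] -/
theorem zcU_z : zcU P Ad z₀ = ((boolUnpair w).2).take (P.cap (Cw).n (Cw).L) := by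
  rw [zcU, Function.comp_apply, fanoutFn_apply, Function.comp_apply, LU_z, FProg.capU_apply, zF_z, takeFn_boolPair, length_ones', length_ones']
  rfl
/-- The padding. [folklore] -/
theorem padU_z : padU P Ad z₀ = List.replicate (P.W (Cw).n (Cw).L - (2 * (((boolUnpair w).2).take (P.cap (Cw).n (Cw).L)).length + 2)) false := by
  simp only [padU, Function.comp_apply, fanoutFn_apply, zcU_z, onesFn_eq_ones, concatFn_boolPair, Com.ones_append, LU_z, FProg.WU_apply,
    dropFn_boolPair, Kannan.zerosFn_apply, List.length_drop, length_ones', two_mul]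
  rfl
/-- `encU ⟨w, r⟩ = enc n L z`. [folklore] -/
theorem encU_z : encU P Ad z₀ = P.enc (Cw).n (Cw).L (boolUnpair w).2 := by rw [encU, fanoutFn_apply, zcU_z, padU_z, Params.enc]
/-- `yU ⟨w, r⟩` is the image `yOf ℓ₀ ℓ₁ z`. [folklore] -/
theorem yU_z : yU P Ad z₀ = (Cw).yOf (l0v P Ad w r) (l1v P Ad w r) (boolUnpair w).2 := by
  rw [yU, Function.comp_apply, fanoutFn_apply, Function.comp_apply, fanoutFn_apply, bitsTU_z l0U_z, bitsTU_z l1U_z, encU_z, concatFn_boolPair,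
    concatFn_boolPair, Ctx.yOf]
  rfl

variable (P Ad w r) in
/-- **The record `x`** on `⟨w, r⟩`. [folklore] -/
def xrec : List Bool :=
  boolPair r (boolPair (ones (mv P Ad w r)) (boolPair (ones (Cw).L) (boolPair (ones (Cw).t) (boolPair (ones (Cw).il) (boolPair (ones (Cw).klen)
    (boolPair (ones (hLen (Cw).N)) (boolPair (ones (eLen (Cw).N)) (boolPair (ones (kapv P Ad w r)) (boolPair (ones ((Cw).blk (kapv P Ad w r)))
      (boolPair (ones (Cw).T) (boolPair (ones (Mv P Ad w r)) ((Cw).yOf (l0v P Ad w r) (l1v P Ad w r) (boolUnpair w).2))))))))))))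

/-- `xU ⟨w, r⟩` is the record `x`. [folklore] -/
theorem xU_z : xU P Ad z₀ = xrec P Ad w r := by
  rw [xU]
  simp only [fanoutFn_apply, sndF_boolPair, mU_z, LU_z, tUU_z, ilU_z, klU_z, hLU_z, eLU_z, kapU_z, blkU_z, TU_z, MU_z, yU_z, xrec]

/-- **The initial record** on `⟨w, r⟩`. [folklore] -/
theorem initU_z : initU P Ad z₀ = boolPair (xrec P Ad w r) (boolPair (encodeNat (Mv P Ad w r)) (boolPair [false] [false])) := by
  rw [initU, fanoutFn_apply, fanoutFn_apply, xU_z, Function.comp_apply, MU_z, lenBinF_apply, length_ones']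

/-- The record is at least `M` long (it holds `1^M`). [folklore] -/
theorem Mv_le_length_xrec : Mv P Ad w r ≤ (xrec P Ad w r).length := by
  simp only [xrec, length_boolPair, length_ones']
  omega

end Values1

/-! ### Values of stage 2 on a loop record `⟨x, ⟨bin k, state⟩⟩` -/

section Values2

variable (P Ad)
variable (w r : List Bool)

local notation "Cw" => Cv P Ad w r
local notation "xr" => xrec P Ad w r

/-- The image used by the machine. [folklore] -/
def yv : List Bool := (Cw).yOf (l0v P Ad w r) (l1v P Ad w r) (boolUnpair w).2
/-- The coin block of attempt `a`. [folklore] -/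
def blockv (a : ℕ) : List Bool := (r.drop (a * (Cw).blk (kapv P Ad w r))).take ((Cw).blk (kapv P Ad w r))
/-- The level of attempt `a`: `L − a/T`. [folklore] -/
def lvlv (a : ℕ) : ℕ := (Cw).L - a / (Cw).T
/-- **Attempt `a` of the machine** (as the `att` of the distinguisher file). [folklore] -/
def attOpt (a : ℕ) : Option Bool := (Cw).att (kapv P Ad w r) (yv P Ad w r) (lvlv P Ad w r a) (blockv P Ad w r a)
/-- The encoding of the loop state `none ↦ ⟨0, 0⟩`, `some b ↦ ⟨1, b⟩`. [folklore] -/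
def stEnc (o : Option Bool) : List Bool := o.elim (boolPair [false] [false]) fun b => boolPair [true] [b]

variable {P Ad w r}

/-- The fields of the record inside a loop record. [folklore] -/
theorem fld_pair (i : ℕ) (s : List Bool) : fld i (boolPair xr s) = nthF i xr := by rw [fld, Function.comp_apply, fstF_boolPair]

/-- Field `0`: `r`. [folklore] -/
@[simp] theorem fld0 (s : List Bool) : fld 0 (boolPair xr s) = r := by rw [fld_pair]; simp [xrec]
/-- Field `1`: `1^m`. [folklore] -/
@[simp] theorem fld1 (s : List Bool) : fld 1 (boolPair xr s) = ones (mv P Ad w r) := by rw [fld_pair]; simp [xrec]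
/-- Field `2`: `1^L`. [folklore] -/
@[simp] theorem fld2 (s : List Bool) : fld 2 (boolPair xr s) = ones (Cw).L := by rw [fld_pair]; simp [xrec]
/-- Field `3`: `1^t`. [folklore] -/
@[simp] theorem fld3 (s : List Bool) : fld 3 (boolPair xr s) = ones (Cw).t := by rw [fld_pair]; simp [xrec]
/-- Field `4`: `1^{il}`. [folklore] -/
@[simp] theorem fld4 (s : List Bool) : fld 4 (boolPair xr s) = ones (Cw).il := by rw [fld_pair]; simp [xrec]
/-- Field `5`: `1^{klen}`. [folklore] -/
@[simp] theorem fld5 (s : List Bool) : fld 5 (boolPair xr s) = ones (Cw).klen := by rw [fld_pair]; simp [xrec]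
/-- Field `6`: `1^{hLen N}`. [folklore] -/
@[simp] theorem fld6 (s : List Bool) : fld 6 (boolPair xr s) = ones (hLen (Cw).N) := by rw [fld_pair]; simp [xrec]
/-- Field `7`: `1^{eLen N}`. [folklore] -/
@[simp] theorem fld7 (s : List Bool) : fld 7 (boolPair xr s) = ones (eLen (Cw).N) := by rw [fld_pair]; simp [xrec]
/-- Field `8`: `1^κ`. [folklore] -/
@[simp] theorem fld8 (s : List Bool) : fld 8 (boolPair xr s) = ones (kapv P Ad w r) := by rw [fld_pair]; simp [xrec]
/-- Field `9`: `1^{blk}`. [folklore] -/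
@[simp] theorem fld9 (s : List Bool) : fld 9 (boolPair xr s) = ones ((Cw).blk (kapv P Ad w r)) := by rw [fld_pair]; simp [xrec]
/-- Field `10`: `1^T`. [folklore] -/
@[simp] theorem fld10 (s : List Bool) : fld 10 (boolPair xr s) = ones (Cw).T := by rw [fld_pair]; simp [xrec]
/-- Field `11`: `1^M`. [folklore] -/
@[simp] theorem fld11 (s : List Bool) : fld 11 (boolPair xr s) = ones (Mv P Ad w r) := by rw [fld_pair]; simp [xrec]
/-- The image field. [folklore] -/
@[simp] theorem yA_pair (s : List Bool) : yA (boolPair xr s) = yv P Ad w r := by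
  rw [yA, Function.comp_apply, fstF_boolPair]; simp [xrec, sndPow, yv]

variable {k : ℕ} (hkM : k ≤ Mv P Ad w r) (st : List Bool)
include hkM

local notation "zz" => boolPair xr (boolPair (encodeNat k) st)

/-- `1^k`. [folklore] -/
theorem kU_zz : kU zz = ones k := by
  rw [kU, Function.comp_apply, fanoutFn_apply, fld11, nthF_succ_boolPair, nthF_zero_boolPair, binToUnaryFn_boolPair, bitsToNat_encodeNat,
    length_ones', min_eq_left hkM]
/-- `1^{M − k}`. [folklore] -/
theorem aU_zz : aU zz = ones (Mv P Ad w r - k) := by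
  rw [aU, Function.comp_apply, fanoutFn_apply, kU_zz hkM, fld11, dropFn_boolPair, length_ones']; simp [ones]
/-- `1^{(M−k)/T}`. [folklore] -/
theorem qU_zz : qU zz = ones ((Mv P Ad w r - k) / (Cw).T) := by
  rw [qU, Function.comp_apply, Function.comp_apply, fanoutFn_apply, fld10, aU_zz hkM, divModFn_boolPair, fstF_boolPair]
/-- `1^i`, `i = L − (M − k)/T`. [folklore] -/
theorem iU_zz : iU zz = ones (lvlv P Ad w r (Mv P Ad w r - k)) := by
  rw [iU, Function.comp_apply, fanoutFn_apply, qU_zz hkM, fld2, dropFn_boolPair, length_ones', lvlv]; simp [ones]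
/-- The coin block of the attempt. [folklore] -/
theorem blockU_zz : blockU zz = blockv P Ad w r (Mv P Ad w r - k) := by
  rw [blockU, Function.comp_apply, fanoutFn_apply, fld9, Function.comp_apply, fanoutFn_apply, Function.comp_apply, umulFn_apply, fanoutFn_apply,
    fstF_boolPair, sndF_boolPair, aU_zz hkM, fld9, length_ones', length_ones', fld0, dropFn_boolPair, length_ones', takeFn_boolPair,
    length_ones', blockv]
/-- The key. [folklore] -/
theorem ρU_zz : ρU zz = (blockv P Ad w r (Mv P Ad w r - k)).take (Cw).klen := by
  rw [ρU, Function.comp_apply, fanoutFn_apply, fld5, blockU_zz hkM, takeFn_boolPair, length_ones']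
/-- The target. [folklore] -/
theorem αU_zz : αU zz = ((blockv P Ad w r (Mv P Ad w r - k)).drop (Cw).klen).take (hLen (Cw).N) := by
  rw [αU, Function.comp_apply, fanoutFn_apply, fld6, Function.comp_apply, fanoutFn_apply, fld5, blockU_zz hkM, dropFn_boolPair, length_ones',
    takeFn_boolPair, length_ones']
/-- `A`'s coins. [folklore] -/
theorem rAU_zz : rAU zz = ((blockv P Ad w r (Mv P Ad w r - k)).drop ((Cw).klen + hLen (Cw).N)).take (kapv P Ad w r) := by
  rw [rAU, Function.comp_apply, fanoutFn_apply, fld8, Function.comp_apply, fanoutFn_apply, Function.comp_apply, fanoutFn_apply, fld5, fld6,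
    concatFn_boolPair, Com.ones_append, blockU_zz hkM, dropFn_boolPair, length_ones', takeFn_boolPair, length_ones']
/-- The index block. [folklore] -/
theorem ιU_zz : ιU zz = (Cw).ιb (lvlv P Ad w r (Mv P Ad w r - k)) := by
  rw [ιU, Function.comp_apply, fanoutFn_apply, Function.comp_apply, iU_zz hkM, lenBinF_apply, length_ones', Function.comp_apply, Function.comp_apply,
    fanoutFn_apply, Function.comp_apply, iU_zz hkM, lenBinF_apply, length_ones', fld4, dropFn_boolPair, Kannan.zerosFn_apply, List.length_drop,
    length_ones', concatFn_boolPair, Ctx.ιb, Params.bitsT]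
/-- `1^{i + eLen N}`. [folklore] -/
theorem ieU_zz : ieU zz = ones (lvlv P Ad w r (Mv P Ad w r - k) + eLen (Cw).N) := by
  rw [ieU, Function.comp_apply, fanoutFn_apply, iU_zz hkM, fld7, concatFn_boolPair, Com.ones_append]
/-- The masked target. [folklore] -/
theorem maskU_zz : maskU zz = maskTo (Cw).N (lvlv P Ad w r (Mv P Ad w r - k)) (((blockv P Ad w r (Mv P Ad w r - k)).drop (Cw).klen).take (hLen (Cw).N)) := by
  rw [maskU, Function.comp_apply, fanoutFn_apply, Function.comp_apply, fanoutFn_apply, ieU_zz hkM, αU_zz hkM, takeFn_boolPair, length_ones',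
    Function.comp_apply, Function.comp_apply, fanoutFn_apply, ieU_zz hkM, fld6, dropFn_boolPair, length_ones', Kannan.zerosFn_apply,
    List.length_drop, length_ones', concatFn_boolPair, maskTo]

omit hkM in
/-- The index of the index block is the level (no length condition: `⟦bitsT il i⟧ = i` and `i ≤ L ≤ N`). [folklore] -/
theorem icap_ιb_lvlv (a : ℕ) : icap (Cw).N ((Cw).ιb (lvlv P Ad w r a)) = lvlv P Ad w r a := by
  rw [icap, Ctx.ιb, Params.bitsToNat_bitsT, min_eq_left]
  have h1 : (Cw).L ≤ (Cw).N := nLen_le _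
  have h2 : lvlv P Ad w r a ≤ (Cw).L := Nat.sub_le _ _
  omega

/-- The query body. [folklore] -/
theorem bodyQU_zz : bodyQU zz = HILL.body (Cw).N (yv P Ad w r) ((Cw).ιb (lvlv P Ad w r (Mv P Ad w r - k)))
    (((blockv P Ad w r (Mv P Ad w r - k)).drop (Cw).klen).take (hLen (Cw).N)) ((blockv P Ad w r (Mv P Ad w r - k)).take (Cw).klen) := by
  rw [bodyQU, Function.comp_apply, fanoutFn_apply, Function.comp_apply, fanoutFn_apply, Function.comp_apply, fanoutFn_apply, yA_pair,
    maskU_zz hkM, ιU_zz hkM, ρU_zz hkM, concatFn_boolPair, concatFn_boolPair, concatFn_boolPair, HILL.body, icap_ιb_lvlv]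

/-- The query. [folklore] -/
theorem qryU_zz : qryU zz = (Cw).qry (yv P Ad w r) (lvlv P Ad w r (Mv P Ad w r - k))
    (((blockv P Ad w r (Mv P Ad w r - k)).drop (Cw).klen).take (hLen (Cw).N)) ((blockv P Ad w r (Mv P Ad w r - k)).take (Cw).klen) := by
  rw [qryU, fanoutFn_apply, fld1, bodyQU_zz hkM, Ctx.qry, ones_eq_unary]; rfl

/-- The answer of the inverter. [folklore] -/
theorem ansU_zz : ansU Ad zz = Ad.A.run ((Cw).qry (yv P Ad w r) (lvlv P Ad w r (Mv P Ad w r - k))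
    (((blockv P Ad w r (Mv P Ad w r - k)).drop (Cw).klen).take (hLen (Cw).N)) ((blockv P Ad w r (Mv P Ad w r - k)).take (Cw).klen))
    (((blockv P Ad w r (Mv P Ad w r - k)).drop ((Cw).klen + hLen (Cw).N)).take (kapv P Ad w r)) := by
  rw [ansU, Function.comp_apply, fanoutFn_apply, qryU_zz hkM, rAU_zz hkM, LenPres.bFn, Function.comp_apply, boolUnpair_boolPair]; rfl

omit hkM in
/-- Reading a bit with `bitAtFn` and comparing with `1` gives `getD`. [folklore] -/
theorem decide_take_one_eq (l : List Bool) (j : ℕ) : decide ((l.drop j).take 1 = [true]) = l.getD j false := by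
  rw [List.getD_eq_getElem?_getD]
  rcases lt_or_ge j l.length with h | h
  · rw [List.take_one_drop_eq_of_lt_length h, List.getElem?_eq_getElem h]; simp
  · rw [List.drop_of_length_le h, List.getElem?_eq_none h]; simp

/-- **The body on a loop record**: keep a set state, else record the attempt `a = M − k`. [folklore] -/
theorem bodyF_zz (o : Option Bool) : bodyF P Ad (boolPair xr (boolPair (encodeNat k) (stEnc o))) = stEnc (o.or (attOpt P Ad w r (Mv P Ad w r - k))) := by
  have hflag : flagC (boolPair xr (boolPair (encodeNat k) (stEnc o))) = [o.isSome] := by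
    rw [flagC, eqPairFn_fanout_apply]
    cases o <;> simp [stEnc, nthF, fstF, sndF]
  rw [bodyF, iteFn_apply hflag]
  cases o with
  | some b => simp [stEnc]
  | none =>
    simp only [Option.isSome_none, Bool.false_eq_true, if_false, Option.none_or]
    have hvalid : validC P Ad (boolPair xr (boolPair (encodeNat k) (stEnc none))) =
        [decide (P.F (ansU Ad (boolPair xr (boolPair (encodeNat k) (stEnc none)))) = bodyQU (boolPair xr (boolPair (encodeNat k) (stEnc none))))] := by
      rw [validC, Function.comp_apply, fanoutFn_apply, Function.comp_apply, eqPairFn_boolPair]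
    rw [iteFn_apply hvalid, ansU_zz hkM, bodyQU_zz hkM, attOpt, Ctx.att]
    by_cases hv : P.F (Ad.A.run ((Cw).qry (yv P Ad w r) (lvlv P Ad w r (Mv P Ad w r - k))
        (((blockv P Ad w r (Mv P Ad w r - k)).drop (Cw).klen).take (hLen (Cw).N)) ((blockv P Ad w r (Mv P Ad w r - k)).take (Cw).klen))
        (((blockv P Ad w r (Mv P Ad w r - k)).drop ((Cw).klen + hLen (Cw).N)).take (kapv P Ad w r))) =
        HILL.body (Cw).N (yv P Ad w r) ((Cw).ιb (lvlv P Ad w r (Mv P Ad w r - k)))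
          (((blockv P Ad w r (Mv P Ad w r - k)).drop (Cw).klen).take (hLen (Cw).N)) ((blockv P Ad w r (Mv P Ad w r - k)).take (Cw).klen)
    · rw [decide_eq_true hv, if_pos rfl]
      rw [show (Cw).P = P from rfl, show (Cw).A = Ad.A from rfl] ; rw [if_pos hv]
      rw [fanoutFn_apply, bitC, eqPairFn_fanout_apply, Function.comp_apply, fanoutFn_apply, Function.comp_apply, fanoutFn_apply, fld3,
        concatFn_boolPair, Com.ones_append, ansU_zz hkM, bitAtFn_boolPair, length_ones', decide_take_one_eq, stEnc, Ctx.outBit, two_mul]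
      rfl
    · rw [decide_eq_false hv]
      rw [show (Cw).P = P from rfl, show (Cw).A = Ad.A from rfl, if_neg hv]
      simp [stEnc]

end Values2

/-! ### The loop model is the first-success scan -/

section Loop

variable {P : Params} {Ad : Adv} {w r : List Bool}

/-- The first success among the attempts `a, a + 1, …, a + n − 1`. [folklore] -/
def firstOpt (P : Params) (Ad : Adv) (w r : List Bool) : ℕ → ℕ → Option Bool
  | _, 0 => none
  | a, n + 1 => (attOpt P Ad w r a).or (firstOpt P Ad w r (a + 1) n)

/-- **The loop model from counter `k`** continues a state `o` with the first success among the attempts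
`M − k, …, M − 1`. [folklore] -/
theorem loopModel_eq : ∀ (k : ℕ), k ≤ Mv P Ad w r → ∀ o : Option Bool,
    loopModel (bodyF P Ad) (xrec P Ad w r) k (stEnc o) = stEnc (o.or (firstOpt P Ad w r (Mv P Ad w r - k) k))
  | 0, _, o => by simp [loopModel, firstOpt]
  | k + 1, hk, o => by
    rw [loopModel, bodyF_zz hk, loopModel_eq k (by omega), firstOpt, Option.or_assoc, show Mv P Ad w r - (k + 1) + 1 = Mv P Ad w r - k by omega]

/-- **The scan of the distinguisher file along the machine's schedule is the first success**: for a list of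
levels `is` that are the levels of the attempts `a, a + 1, …`, the scan on the coins after `a` blocks is
`firstOpt a |is|`, with the fresh coin after all blocks as default. [folklore] -/
theorem scan_eq_firstOpt : ∀ (is : List ℕ) (a : ℕ), (∀ j (h : j < is.length), is[j] = lvlv P Ad w r (a + j)) →
    (Cv P Ad w r).scan (kapv P Ad w r) (yv P Ad w r) is (r.drop (a * (Cv P Ad w r).blk (kapv P Ad w r))) =
      (firstOpt P Ad w r a is.length).getD (r.getD ((a + is.length) * (Cv P Ad w r).blk (kapv P Ad w r)) false)
  | [], a, _ => by
    simp only [Ctx.scan, List.length_nil, firstOpt, Option.getD_none, Nat.add_zero, List.getD_eq_getElem?_getD, List.getElem?_drop,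
      Nat.add_zero]
  | i :: is, a, his => by
    have h0 : i = lvlv P Ad w r a := by have := his 0 (by simp); rwa [List.getElem_cons_zero] at this
    have hatt : (Cv P Ad w r).att (kapv P Ad w r) (yv P Ad w r) i ((r.drop (a * (Cv P Ad w r).blk (kapv P Ad w r))).take ((Cv P Ad w r).blk (kapv P Ad w r))) =
        attOpt P Ad w r a := by rw [attOpt, h0, blockv]
    rw [Ctx.scan, hatt, List.length_cons, firstOpt]
    have ih := scan_eq_firstOpt is (a + 1) (fun j hj => by
      have := his (j + 1) (by simpa using hj); simpa [Nat.add_assoc, Nat.add_comm 1 j] using this)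
    rw [List.drop_drop, show a * (Cv P Ad w r).blk (kapv P Ad w r) + (Cv P Ad w r).blk (kapv P Ad w r) =
      (a + 1) * (Cv P Ad w r).blk (kapv P Ad w r) by ring, ih, show a + 1 + is.length = a + (is.length + 1) by ring]
    cases attOpt P Ad w r a <;> simp

/-- The schedule as a `range`: `levelsGE lo n = [lo + n − 1 − j/T : j < n T]`. [folklore] -/
theorem levelsGE_eq_map (C : Ctx) (lo : ℕ) : ∀ n, C.levelsGE lo n = (List.range (n * C.T)).map fun j => lo + n - 1 - j / C.T
  | 0 => by simp [Ctx.levelsGE]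
  | n + 1 => by
    rw [Ctx.levelsGE, levelsGE_eq_map C lo n, Nat.succ_mul, Nat.add_comm (n * C.T) C.T, List.range_add, List.map_append, List.map_map]
    congr 1
    · symm
      rw [List.eq_replicate_iff]
      refine ⟨by simp, fun b hb => ?_⟩
      obtain ⟨j, hj, rfl⟩ := List.mem_map.1 hb
      rw [List.mem_range] at hj
      rw [Nat.div_eq_of_lt hj]; omega
    · refine List.map_congr_left fun j hj => ?_
      rw [List.mem_range] at hj
      have hT : 0 < C.T := Nat.pos_of_ne_zero fun h => by rw [h, mul_zero] at hj; omega
      rw [Function.comp_apply, Nat.add_div_left _ hT]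
      have : j / C.T < n := Nat.div_lt_of_lt_mul (by rw [mul_comm]; exact hj)
      omega

/-- The `j`-th level of the full schedule is `L − j/T`. [folklore] -/
theorem levels_getElem (C : Ctx) {j : ℕ} (hj : j < C.levels.length) : C.levels[j] = C.L - j / C.T := by
  have h := levelsGE_eq_map C 0 (C.L + 1)
  simp only [Ctx.levels] at hj ⊢
  simp only [h, List.getElem_map, List.getElem_range]
  omega

/-- **`dRun` is the first success of the machine's attempts** (or the fresh coin). [folklore] -/
theorem dRun_eq : P.dRun Ad w r = (firstOpt P Ad w r 0 (Mv P Ad w r)).getD (r.getD (Mv P Ad w r * (Cv P Ad w r).blk (kapv P Ad w r)) false) := by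
  have hlen : (Cv P Ad w r).levels.length = Mv P Ad w r := (Cv P Ad w r).length_levelsGE 0 _
  have h := scan_eq_firstOpt (P := P) (Ad := Ad) (w := w) (r := r) (Cv P Ad w r).levels 0 (fun j hj => by
    rw [levels_getElem _ hj, lvlv, zero_add])
  rw [zero_mul, List.drop_zero, zero_add, hlen] at h
  rw [← h]
  rfl

end Loop

/-! ### The program computes `D` -/

/-- The output stage on the final loop record. [folklore] -/
theorem outF_final {P : Params} {Ad : Adv} {w r : List Bool} (o : Option Bool) :
    outF (boolPair (xrec P Ad w r) (boolPair [] (stEnc o))) = [o.getD (r.getD (Mv P Ad w r * (Cv P Ad w r).blk (kapv P Ad w r)) false)] := by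
  have hflag : flagC (boolPair (xrec P Ad w r) (boolPair [] (stEnc o))) = [o.isSome] := by
    rw [flagC, eqPairFn_fanout_apply]
    cases o <;> simp [stEnc, nthF, fstF, sndF]
  rw [outF, iteFn_apply hflag]
  cases o with
  | some b => simp [stEnc, sndPow, sndF]
  | none =>
    simp only [Option.isSome_none, Bool.false_eq_true, if_false, Option.getD_none]
    rw [coinC, eqPairFn_fanout_apply, Function.comp_apply, fanoutFn_apply, Function.comp_apply, umulFn_apply, fanoutFn_apply, fstF_boolPair,
      sndF_boolPair, fld11, fld9, length_ones', length_ones', fld0, bitAtFn_boolPair, length_ones', decide_take_one_eq]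

/-- **The pipeline computes the run function of `D`** on every input: `DF ⟨w, r⟩ = [dRun w r]`. [folklore] -/
theorem DF_apply (P : Params) (Ad : Adv) (w r : List Bool) : DF P Ad (boolPair w r) = [P.dRun Ad w r] := by
  rw [DF, Function.comp_apply, Function.comp_apply, initU_z, loopF]
  simp only [fstF_boolPair, eval_X]
  rw [iterate_loopStep (bodyF P Ad) (xrec P Ad w r) (Mv P Ad w r) _ _ Mv_le_length_xrec,
    show boolPair [false] [false] = stEnc none from rfl, loopModel_eq _ le_rfl, Nat.sub_self, Option.none_or, outF_final, dRun_eq]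

/-- **The distinguisher is PPT** for polynomial-time samplers, a PPT inverter and a polynomially bounded coin budget
— the efficiency hypothesis of `Params.isWeaklyOneWay_F` (pattern of `CommitmentOneWay.DProg.dist_isPPT`).
[cite: Goldreich2001, §3.8 Exercise 11 (guideline: the reduction is polynomial-time)] -/
theorem dist_isPPT {P : Params} {Ad : Adv} (h0 : P.S0.IsPolyTime unaryEncodeNat id) (h1 : P.S1.IsPolyTime unaryEncodeNat id)
    (hA : IsPPT Ad.A id) {cl : ℕ → ℕ} (hcl : ∃ pc : Polynomial ℕ, ∀ L, cl L ≤ pc.eval L) : IsPPT (P.dist Ad cl) encodeBool := by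
  refine ⟨?_, hcl⟩
  exact PolyTimeComputable.of_encode_eq (f := DF P Ad)
    (fun p : List Bool × List Bool => boolPair (id p.1) p.2) (fun _ => rfl)
    (fun p => by
      obtain ⟨w, r⟩ := p
      simp only [id]
      rw [DF_apply]
      rfl)
    (DF_mem_FP h0 h1 hA)

end DProg

end FarApartOWF

end

end Literature.Computability.Cryptography

namespace Literature.Computability.Cryptography

/-! ## Part VIII — the discharge of `Goldreich2001_owfExist_of_indistinguishable_farApart` -/

/-- **Discharge of `Goldreich2001_owfExist_of_indistinguishable_farApart`.** Two exactly polynomial-time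
samplable ensembles that are computationally indistinguishable and statistically far apart give one-way
functions. The proof is the one of Goldreich's guideline to §3.8 Exercise 11 in the tree's machine model,
carried out in `IndistinguishableFarEnsembles{Math,Sampler,Function,Attempt}.lean` and Parts V–VII above: the
two samplers give the length-preserving function `f̃` ("`(σ, r) ↦ S_σ(r)`" with coin-count guesses),
Impagliazzo–Luby's hashed function `F = g f̃` of Ch. 2 Exercise 17 is shown WEAKLY one-way — an inverter of `F`
yields, by a top-down scan over the hash levels, an almost uniformly distributed preimage and hence (its selector
bit) a distinguisher of advantage `≥ Δ(Xₙ, Yₙ)² − o(·) ≥ 1/(2 pd(n)²)` infinitely often, the Cauchy–Schwarz bound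
replacing the guideline's preliminary amplification to almost-disjointness — and Yao's amplification
(Thm. 2.3.2, `weakOWFExist_iff_OWFExist_holds`) gives a one-way function.
[cite: Goldreich2001, §3.8 Exercise 11 (PDF p. 212) with Ch. 2 Exercise 17 (PDF p. 126) and Thm. 2.3.2; Goldreich2010, Exercise 2.8 (PDF p. 46)] -/
theorem Goldreich2001_owfExist_of_indistinguishable_farApart_holds : Goldreich2001_owfExist_of_indistinguishable_farApart :=
  fun X Y hX hY hind hfar =>
    weakOWFExist_iff_OWFExist_holds.1
      (FarApartOWF.Params.weakOWFExist_of_samplers X Y hX hY hind hfar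
        fun _ _ _ h0 h1 hA hcl => FarApartOWF.DProg.dist_isPPT h0 h1 hA hcl)

end Literature.Computability.Cryptography
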